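import Literature.Geometry.Lorentzian.KerrLowFrequencyProfiles
import Literature.Geometry.Lorentzian.KerrLowFrequencyPotential
import Literature.Geometry.Lorentzian.KerrTrappingMultipliers
import HarnessLib

/-!
# The axisymmetric low-frequency subrange of `𝓖_♭`: Proposition 8.7.2 of
# Dafermos–Rodnianski–Shlapentokh-Rothman, with explicit multipliers

(family `gr`, infrastructure for statement **gr.S24**; namespace `Literature.Geometry.Lorentzian.Kerr`)

Dafermos–Rodnianski–Shlapentokh-Rothman (*Decay for solutions of the wave equation on Kerr exterior
spacetimes III*, arXiv:1402.7034 = Ann. of Math. 183 (2016)), Proposition 8.7.2: for `a₀ < M`,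
all `ω_high, ε_width > 0`, all `ω_low > 0` sufficiently small, all `R_∞` large, all `E ≥ 2`,
`0 ≤ a ≤ a₀` and all `(ω, m, Λ) ∈ 𝓖_♭(ω_high, ε_width)` with `|ω| ≤ ω_low` and **`m = 0`** there are
functions `y, ŷ, h` with `|y| + |ŷ| + |h| ≤ B`, `y = 1, h = 0, ŷ = 0` for `r* ≥ R*_∞`, such that
for all smooth solutions of the radial o.d.e. `u'' + (ω² − V)u = H` with the outgoing boundary
conditions (eq:b±),
`b ∫_{R₋*}^{R₊*} (|u'|² + |u|²) ≤ −∫ (2(y + ŷ) Re(u'H̄) + h Re(uH̄) + Eω Im(Hū))`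
(current `Ϙ^h + ϟ^y + ϟ^ŷ − E Q^T`; "since this proposition concerns a non-superradiant regime, we
may set `χ₁ = 0`").

This file proves it with **explicit multipliers**: `Kerr.axiLowFreqMultipliers M a ω Λ R P`, the
`Multipliers` record (`KerrCombinedCurrent`) with `f = χ₁ = 0`, `χ₂ = 1`,
`h(r*) = σ(h_F(r* − x₀) + h_N(x₁ − r*) − 1)` and `y(r*) = σ(Y_F(r* − x₀) − Y_N(x₁ − r*))`, where
`(h_F, Y_F)` resp. `(h_N, Y_N)` are the one-sided log-zone profiles of `KerrLowFrequencyProfiles`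
for the potential `W(t) = V(R(t + x₀))` towards `r* = +∞` resp. `W̃(t) = V(R(x₁ − t))` towards the
horizon (for `m = 0`, `V(r₊) = 0`, so `Ṽ = V − V|_{r=r₊} = V` in (haty2)), and `σ = 1/Y_F(∞)`
normalises `y = 1` near `r* = ∞`. The pointwise bulk coefficient is non-negative by
`Kerr.lowFreq_coeff_nonneg` on both ends and equals `σ(V − ω²) ≥ σV/2` in the middle; the boundary
terms at `r* = ±∞` have the good signs for `E ≥ 2` because `|y(−∞)| ≤ y(∞) = 1`
(`KerrCombinedCurrent.combined_estimate_of_boundary_sign`).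

* `Kerr.IsTortoiseRadius.sub_rPlus_le` — the exponential approach `R − r₊ ≤ s_N e^{−c₁(x_N − r*)}`
  to the horizon along a tortoise radius (`c₁ = √(M² − a²)/(4r₊²)`).
* `Kerr.farPotential`, `Kerr.nearPotential` (+ `…Deriv`) and their data lemmas
  `Kerr.axi_far_data`, `Kerr.axi_near_data` (the hypotheses of `lowFreq_coeff_nonneg`).
* `Kerr.LowFreqParams`, `Kerr.axiLowFreqMultipliers`, `Kerr.hasDerivs_axiLowFreqMultipliers`,
  zone values, end limits, the bulk identity `Kerr.combinedBulk_axiLowFreq`.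
* **`Kerr.axiLowFreq_estimate_of_params`** (the estimate for given parameters) and
  **`Kerr.axiLowFreq_estimate`** (Prop. 8.7.2: existence of `ω₀, b, B, X_∞` uniform in the
  triple, `Λ ≤ Λ₁ = ε_width⁻¹ω_high²`), `Kerr.axiLowFreq_estimate_of_isFreqFlat` (the `𝓖_♭` form).

All constants (`ω₀`, `b`, `X_∞`, and the parameters `P`) are explicit functions of `M`, `a`,
`Λ₁`, `δ₀`, `R_b`, of two points of the tortoise radius `R` (normalisation of `r*`) and of the
bounds `D₁, D₂` for `φ', φ''`; the printed uniformity in `a ∈ [0, a₀]` is not formalised here (it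
would follow from these formulas, which are monotone in `r₊(a) ∈ [r₊(a₀), 2M]` and
`√(M² − a²) ≥ √(M² − a₀²)`).

Sign conventions for the source term are those of `KerrCombinedCurrent.combinedSource` (as in
`KerrTrappingEstimate`, `KerrTimeDominatedEstimate`); with `f = χ₁ = 0`, `χ₂ = 1`, `ϖ = ω` it
reads `−h Re(uH̄) − 2y Re(u'H̄) + Eω Im(Hū)` (the printed display of Prop. 8.7.2 carries the
`Eω Im(Hū)` term inside `−∫(…)`, a sign slip relative to (Hfhy) of Theorem 8.1 and to §7).

No named facts (D-0026); everything is proved.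

## References

* M. Dafermos, I. Rodnianski, Y. Shlapentokh-Rothman, arXiv:1402.7034 = Ann. of Math. 183 (2016),
  §8.7.2, Prop. 8.7.2, and §8.7.1 (proof of Prop. 8.7.1, which Prop. 8.7.2 repeats "mutatis
  mutandis") (key `DafermosRodnianskiShlapentokhrothman2014`).
-/

noncomputable section

open Set Filter Topology MeasureTheory
open scoped InnerProductSpace ComplexConjugate

namespace Literature.Geometry.Lorentzian

namespace Kerr

/-! ### Exponential approach to the horizon along a tortoise radius -/

namespace IsTortoiseRadius

variable {M a : ℝ} {R : ℝ → ℝ}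

/-- **`R − r₊` decays at least exponentially towards the horizon**: for `x ≤ c` with
`R(c) ≤ 2r₊`, `R(x) − r₊ ≤ (R(c) − r₊)·exp(−c₁(c − x))`, `c₁ = √(M² − a²)/(4r₊²)` (from
`dR/dr* = Δ/(R² + a²) ≥ (R − r₊)√(M² − a²)/R²`). [folklore] -/
theorem sub_rPlus_le (hR : IsTortoiseRadius M a R) (hMa : IsSubextremal M a) {x c : ℝ}
    (hxc : x ≤ c) (hc : R c ≤ 2 * rPlus M a) :
    R x - rPlus M a ≤
      (R c - rPlus M a) * Real.exp (-(√(M ^ 2 - a ^ 2) / (4 * rPlus M a ^ 2)) * (c - x)) := by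
  have hM := hMa.pos
  have hrp0 : 0 < rPlus M a := hM.trans_le (M_le_rPlus M a)
  set c₁ : ℝ := √(M ^ 2 - a ^ 2) / (4 * rPlus M a ^ 2) with hc₁
  set G : ℝ → ℝ := fun t ↦ Real.log (R t - rPlus M a) with hG
  have hpos : ∀ t, 0 < R t - rPlus M a := fun t ↦ sub_pos.2 (hR.rPlus_lt t)
  have hGd : ∀ t, HasDerivAt G ((delta M a (R t) / (R t ^ 2 + a ^ 2)) / (R t - rPlus M a)) t :=
    fun t ↦ ((hR.hasDerivAt t).sub_const (rPlus M a)).log (hpos t).ne'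
  have hmono := (hR.strictMono hMa).monotone
  -- `G' ≥ c₁` on `[x, c]` (there `R ≤ R c ≤ 2r₊`)
  have hC : ∀ t ∈ interior (Icc x c), c₁ ≤ deriv G t := by
    intro t ht
    rw [interior_Icc] at ht
    rw [(hGd t).deriv]
    have hRt : R t ≤ 2 * rPlus M a := (hmono ht.2.le).trans hc
    have hRt0 : 0 < R t := hrp0.trans (hR.rPlus_lt t)
    have hq := delta_div_ge hMa (hR.rPlus_lt t).le
    rw [le_div_iff₀ (hpos t)]
    refine le_trans ?_ hq
    rw [hc₁, div_mul_eq_mul_div, div_le_div_iff₀ (by positivity) (by positivity)]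
    have hs0 : 0 ≤ √(M ^ 2 - a ^ 2) * (R t - rPlus M a) := mul_nonneg (Real.sqrt_nonneg _) (hpos t).le
    have : R t ^ 2 ≤ 4 * rPlus M a ^ 2 := by nlinarith
    nlinarith [mul_le_mul_of_nonneg_left this hs0]
  have hmvt := (convex_Icc x c).mul_sub_le_image_sub_of_le_deriv
    (fun t _ ↦ (hGd t).continuousAt.continuousWithinAt)
    (fun t _ ↦ (hGd t).differentiableAt.differentiableWithinAt) hC
    x (left_mem_Icc.2 hxc) c (right_mem_Icc.2 hxc) hxc
  have hlog : Real.log (R x - rPlus M a) ≤ Real.log (R c - rPlus M a) + -c₁ * (c - x) := by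
    have : c₁ * (c - x) ≤ G c - G x := hmvt
    simp only [hG] at this
    linarith
  have h := Real.exp_le_exp.2 hlog
  rwa [Real.exp_log (hpos x), Real.exp_add, Real.exp_log (hpos c)] at h

end IsTortoiseRadius

/-! ### The one-sided potentials `W(t) = V(R(t + x₀))` and `W̃(t) = V(R(x₁ − t))` -/

/-- The far-side potential `W(t) = V(R(t + x₀))` (`m = 0`) in the variable `t = r* − x₀`.
[cite: DafermosRodnianskiShlapentokhrothman2014, Prop. 8.7.1 (proof)] -/
def farPotential (M a ω Λ : ℝ) (R : ℝ → ℝ) (x₀ t : ℝ) : ℝ :=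
  sepPotential M a ω 0 Λ (R (t + x₀))

/-- `dW/dt = (dV/dr)(R)·Δ(R)/(R² + a²)` at `R = R(t + x₀)`. [folklore] -/
def farPotentialDeriv (M a ω Λ : ℝ) (R : ℝ → ℝ) (x₀ t : ℝ) : ℝ :=
  deriv (sepPotential M a ω 0 Λ) (R (t + x₀)) *
    (delta M a (R (t + x₀)) / (R (t + x₀) ^ 2 + a ^ 2))

/-- The near-side potential `W̃(t) = V(R(x₁ − t))` (`m = 0`, so `Ṽ = V − V|_{r=r₊} = V`) in the
reflected variable `t = x₁ − r*`. [cite: DafermosRodnianskiShlapentokhrothman2014, Prop. 8.7.1 (proof)] -/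
def nearPotential (M a ω Λ : ℝ) (R : ℝ → ℝ) (x₁ t : ℝ) : ℝ :=
  sepPotential M a ω 0 Λ (R (x₁ - t))

/-- `dW̃/dt = −(dV/dr)(R)·Δ(R)/(R² + a²)` at `R = R(x₁ − t)`. [folklore] -/
def nearPotentialDeriv (M a ω Λ : ℝ) (R : ℝ → ℝ) (x₁ t : ℝ) : ℝ :=
  -(deriv (sepPotential M a ω 0 Λ) (R (x₁ - t)) *
    (delta M a (R (x₁ - t)) / (R (x₁ - t) ^ 2 + a ^ 2)))

section Data

variable {M a ω Λ Λ₁ : ℝ} {R : ℝ → ℝ}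

/-- `W' ` is the derivative of `W`. [folklore] -/
theorem hasDerivAt_farPotential (hR : IsTortoiseRadius M a R) (hMa : IsSubextremal M a)
    (x₀ t : ℝ) :
    HasDerivAt (farPotential M a ω Λ R x₀) (farPotentialDeriv M a ω Λ R x₀ t) t := by
  have h := (hasDerivAt_sepPotential_comp (ω := ω) (m := 0) (Λ := Λ) hR hMa (t + x₀)).comp t
    ((hasDerivAt_id t).add_const x₀)
  unfold farPotential farPotentialDeriv
  simpa [Function.comp_def] using h

/-- `W̃' ` is the derivative of `W̃`. [folklore] -/
theorem hasDerivAt_nearPotential (hR : IsTortoiseRadius M a R) (hMa : IsSubextremal M a)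
    (x₁ t : ℝ) :
    HasDerivAt (nearPotential M a ω Λ R x₁) (nearPotentialDeriv M a ω Λ R x₁ t) t := by
  have h := (hasDerivAt_sepPotential_comp (ω := ω) (m := 0) (Λ := Λ) hR hMa (x₁ - t)).comp t
    ((hasDerivAt_const t x₁).sub (hasDerivAt_id t))
  unfold nearPotential nearPotentialDeriv
  refine (h.congr_of_eventuallyEq (Eventually.of_forall fun s ↦ rfl)).congr_deriv ?_
  simp

/-- **The far-side data** (the hypotheses of `lowFreq_coeff_nonneg` at `r* → +∞`). Let
`R(x_b) = R_b' ≥ 20M`, `x₀ = x_b − R_b'`, `T = R_b' + 1`, `Λ ≥ 0`. Then for `t ≥ T − 1`: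
`R_b' ≤ R(t + x₀) ≤ t`, `W(t) > 0`, `(3/2)W(t) ≤ −tW'(t)` and `W(t) ≥ M/(2t³)`; and for all `t`,
`|W(t)| ≤ 3(Λ + 1)/R(t + x₀)²`-type bounds are those of `abs_sepPotential_le`.
[cite: DafermosRodnianskiShlapentokhrothman2014, Prop. 8.7.1 (proof)] -/
theorem axi_far_data (hMa : IsSubextremal M a) (hR : IsTortoiseRadius M a R) {Rb' xb x₀ T : ℝ}
    (hRb : 20 * M ≤ Rb') (hxb : R xb = Rb') (hx₀ : x₀ = xb - Rb') (hT : T = Rb' + 1)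
    (hΛ : 0 ≤ Λ) {t : ℝ} (ht : T - 1 ≤ t) :
    (Rb' ≤ R (t + x₀) ∧ R (t + x₀) ≤ t) ∧ 0 < farPotential M a ω Λ R x₀ t ∧
      (1 + 1 / 2) * farPotential M a ω Λ R x₀ t ≤ -(t * farPotentialDeriv M a ω Λ R x₀ t) ∧
      M / (2 * t ^ 3) ≤ farPotential M a ω Λ R x₀ t := by
  have hM := hMa.pos
  have haM : |a| ≤ M := le_of_lt hMa
  have hrp2 : rPlus M a ≤ 2 * M := by
    unfold rPlus
    have : √(M ^ 2 - a ^ 2) ≤ M := by rw [Real.sqrt_le_left hM.le]; nlinarith [sq_nonneg a]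
    linarith
  have hxb' : xb ≤ t + x₀ := by rw [hx₀]; linarith
  have hmono := (hR.strictMono hMa).monotone
  have hR1 : Rb' ≤ R (t + x₀) := by rw [← hxb]; exact hmono hxb'
  have hR2 : R (t + x₀) ≤ t := by
    have h := hR.sub_le hMa hxb'
    rw [hxb] at h
    have e : t + x₀ - xb = t - Rb' := by rw [hx₀]; ring
    linarith
  set r := R (t + x₀) with hr
  have hr20 : 20 * M ≤ r := hRb.trans hR1
  have hr4 : 4 * M ≤ r := by linarith
  have hrp : rPlus M a < r := by linarith
  have hr0 : 0 < r := by linarith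
  have hV : 0 < farPotential M a ω Λ R x₀ t := sepPotential_axi_pos hMa hrp hΛ ω
  have hq0 : 0 < delta M a r / (r ^ 2 + a ^ 2) := div_pos (delta_pos haM hrp) (by positivity)
  have hVr : deriv (sepPotential M a ω 0 Λ) r < 0 := deriv_sepPotential_axi_neg hMa hΛ hr20
  have hratio := sepPotential_axi_far_ratio (ω := ω) hM haM hΛ hr20
  refine ⟨⟨hR1, hR2⟩, hV, ?_, ?_⟩
  · unfold farPotential farPotentialDeriv
    rw [← hr]
    have h1 : r * (delta M a r / (r ^ 2 + a ^ 2)) * -deriv (sepPotential M a ω 0 Λ) r ≤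
        t * (delta M a r / (r ^ 2 + a ^ 2)) * -deriv (sepPotential M a ω 0 Λ) r := by
      have : 0 ≤ (delta M a r / (r ^ 2 + a ^ 2)) * -deriv (sepPotential M a ω 0 Λ) r :=
        mul_nonneg hq0.le (by linarith)
      nlinarith
    nlinarith
  · unfold farPotential
    rw [← hr]
    calc M / (2 * t ^ 3) ≤ M / (2 * r ^ 3) := by
          apply div_le_div_of_nonneg_left hM.le (by positivity); gcongr
      _ ≤ sepPotential₁ M a r := sepPotential₁_ge_of_four_mul_le hM haM hr4
      _ ≤ sepPotential M a ω 0 Λ r := sepPotential₁_le_sepPotential_axi haM hrp.le hΛ ω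

/-- **Upper bound for the far-side potential**: `W(t) ≤ 12(Λ + 1)/t²` for `t ≥ T − 1 = R_b'`
(from `|V| ≤ 3Λ/r² + 3M/r³` and `R(t + x₀) ≥ R_b' + (t − R_b')/2 ≥ t/2`). [folklore] -/
theorem axi_farPotential_le (hMa : IsSubextremal M a) (hR : IsTortoiseRadius M a R)
    {Rb' xb x₀ T : ℝ} (hRb : 20 * M ≤ Rb') (hxb : R xb = Rb') (hx₀ : x₀ = xb - Rb')
    (hT : T = Rb' + 1) (hadm : IsAdmissibleTriple a ω 0 Λ) {t : ℝ} (ht : T - 1 ≤ t) :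
    farPotential M a ω Λ R x₀ t ≤ 12 * (Λ + 1) / t ^ 2 := by
  have hM := hMa.pos
  have haM : |a| ≤ M := le_of_lt hMa
  have hΛ := hadm.nonneg
  obtain ⟨⟨hR1, hR2⟩, -, -, -⟩ := axi_far_data (ω := ω) hMa hR hRb hxb hx₀ hT hΛ ht
  have hrp2 : rPlus M a ≤ 2 * M := by
    unfold rPlus
    have : √(M ^ 2 - a ^ 2) ≤ M := by rw [Real.sqrt_le_left hM.le]; nlinarith [sq_nonneg a]
    linarith
  set r := R (t + x₀) with hr
  have hrp : rPlus M a ≤ r := by linarith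
  have hr0 : 0 < r := by linarith
  have ht0 : 0 < t := by linarith
  -- `r ≥ t/2`
  have hxb' : xb ≤ t + x₀ := by rw [hx₀]; linarith
  have hgrow := hR.mul_sub_le hMa hxb'
  rw [hxb] at hgrow
  have hq' : 1 / 2 ≤ delta M a Rb' / (Rb' ^ 2 + a ^ 2) := half_le_delta_div hM haM hRb
  have hrt : t / 2 ≤ r := by
    have e : t + x₀ - xb = t - Rb' := by rw [hx₀]; ring
    rw [e] at hgrow
    have h1 : 1 / 2 * (t - Rb') ≤ R (t + x₀) - Rb' :=
      le_trans (mul_le_mul_of_nonneg_right hq' (by linarith)) hgrow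
    rw [hr]
    linarith
  have hV := abs_sepPotential_le (ω := ω) (m := 0) hM haM hadm hrp
  have hV' := le_abs_self (sepPotential M a ω 0 Λ r)
  unfold farPotential
  rw [← hr]
  have h1 : 3 * Λ / r ^ 2 ≤ 3 * Λ / (t / 2) ^ 2 := by
    apply div_le_div_of_nonneg_left (by positivity) (by positivity); gcongr
  have h2 : 3 * M / r ^ 3 ≤ 3 / (t / 2) ^ 2 := by
    rw [div_le_div_iff₀ (by positivity) (by positivity)]
    have hMr : M ≤ r := (M_le_rPlus M a).trans hrp
    have : (t / 2) ^ 2 ≤ r ^ 2 := by gcongr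
    nlinarith [mul_le_mul this hMr hM.le (by positivity)]
  have e : 3 * Λ / (t / 2) ^ 2 + 3 / (t / 2) ^ 2 = 12 * (Λ + 1) / t ^ 2 := by
    field_simp; ring
  linarith

end Data

section NearData

variable {M a ω Λ Λ₁ : ℝ} {R : ℝ → ℝ}

/-- The near-horizon slope bound `κ₂(Λ₁) = 24Λ₁/r₊³ + 184M/r₊⁴` for `dV/dr` on `r ≥ r₊`, `Λ ≤ Λ₁`.
[folklore] -/
def horizonDerivBound (M a Λ₁ : ℝ) : ℝ :=
  24 * Λ₁ / rPlus M a ^ 3 + 184 * M / rPlus M a ^ 4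

/-- The threshold `T₀' = 12κ₂r₊²/(√(M² − a²)κ_H)` beyond which `(3/2)W̃ ≤ −tW̃'`. [folklore] -/
def nearThreshold (M a Λ₁ : ℝ) : ℝ :=
  12 * horizonDerivBound M a Λ₁ * rPlus M a ^ 2 / (√(M ^ 2 - a ^ 2) * horizonSlope M a)

/-- `κ₂ ≥ 0` and `T₀' ≥ 0` (`Λ₁ ≥ 0`, `|a| < M`). [folklore] -/
theorem horizonDerivBound_nonneg (hMa : IsSubextremal M a) (hΛ₁ : 0 ≤ Λ₁) :
    0 ≤ horizonDerivBound M a Λ₁ ∧ 0 ≤ nearThreshold M a Λ₁ := by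
  have hM := hMa.pos
  have hrp0 : 0 < rPlus M a := hM.trans_le (M_le_rPlus M a)
  have hκ := horizonSlope_pos hMa
  have h1 : 0 ≤ horizonDerivBound M a Λ₁ := by unfold horizonDerivBound; positivity
  refine ⟨h1, ?_⟩
  unfold nearThreshold
  have := Real.sqrt_nonneg (M ^ 2 - a ^ 2)
  positivity

/-- **The near-side data** (the hypotheses of `lowFreq_coeff_nonneg` at the horizon end, for
`m = 0`). Let `0 < s_N ≤ r₊` with `s_N·L(Λ₁) ≤ κ_H/2`, `R(x_N) = r₊ + s_N`, `T' ≥ T₀' + 2`,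
`x₁ = x_N + T' − 1`, `Λ ≤ Λ₁`. Then for `t ≥ T' − 1` (i.e. `r* = x₁ − t ≤ x_N`):
`r₊ < R ≤ r₊ + s_N`, `W̃ > 0`, `(3/2)W̃ ≤ −tW̃'`,
`(κ_H/2)(R − r₊) ≤ W̃ ≤ κ₂(R − r₊)`, and
`s_N e^{−(t − T' + 1)/M} ≤ R − r₊ ≤ s_N e^{−c₁(t − T' + 1)}`, `c₁ = √(M² − a²)/(4r₊²)`.
[cite: DafermosRodnianskiShlapentokhrothman2014, Prop. 8.7.1 (proof)] -/
theorem axi_near_data (hMa : IsSubextremal M a) (hR : IsTortoiseRadius M a R)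
    {sN xN x₁ T' : ℝ} (hadm : IsAdmissibleTriple a ω 0 Λ) (hΛ : Λ ≤ Λ₁) (hsN : 0 < sN)
    (hsNL : sN * horizonCurv M a Λ₁ ≤ horizonSlope M a / 2) (hsNr : sN ≤ rPlus M a)
    (hxN : R xN = rPlus M a + sN) (hT' : nearThreshold M a Λ₁ + 2 ≤ T')
    (hx₁ : x₁ = xN + T' - 1) {t : ℝ} (ht : T' - 1 ≤ t) :
    (rPlus M a < R (x₁ - t) ∧ R (x₁ - t) ≤ rPlus M a + sN) ∧
      0 < nearPotential M a ω Λ R x₁ t ∧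
      (1 + 1 / 2) * nearPotential M a ω Λ R x₁ t ≤ -(t * nearPotentialDeriv M a ω Λ R x₁ t) ∧
      (horizonSlope M a / 2 * (R (x₁ - t) - rPlus M a) ≤ nearPotential M a ω Λ R x₁ t ∧
        nearPotential M a ω Λ R x₁ t ≤ horizonDerivBound M a Λ₁ * (R (x₁ - t) - rPlus M a)) ∧
      (sN * Real.exp (-(t - (T' - 1)) / M) ≤ R (x₁ - t) - rPlus M a ∧
        R (x₁ - t) - rPlus M a ≤
          sN * Real.exp (-(√(M ^ 2 - a ^ 2) / (4 * rPlus M a ^ 2)) * (t - (T' - 1)))) := by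
  have hM := hMa.pos
  have haM : |a| ≤ M := le_of_lt hMa
  have hrpM : M ≤ rPlus M a := M_le_rPlus M a
  have hrp0 : 0 < rPlus M a := hM.trans_le hrpM
  have hΛ0 := hadm.nonneg
  have hΛ₁ : 0 ≤ Λ₁ := hΛ0.trans hΛ
  have hκ := horizonSlope_pos hMa
  obtain ⟨hκ₂, hT₀⟩ := horizonDerivBound_nonneg hMa hΛ₁
  have hsq : 0 < M ^ 2 - a ^ 2 := by
    have := hMa; unfold IsSubextremal at this
    nlinarith [abs_nonneg a, sq_abs a]
  have hroot : 0 < √(M ^ 2 - a ^ 2) := Real.sqrt_pos.2 hsq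
  set x := x₁ - t with hx
  have hxxN : x ≤ xN := by rw [hx, hx₁]; linarith
  have hmono := (hR.strictMono hMa).monotone
  have hRx : R x ≤ rPlus M a + sN := by rw [← hxN]; exact hmono hxxN
  have hRx' : rPlus M a < R x := hR.rPlus_lt x
  set r := R x with hr
  set s := r - rPlus M a with hs
  have hs0 : 0 < s := by rw [hs]; linarith
  have hssN : s ≤ sN := by rw [hs]; linarith
  have hr2 : r ≤ 2 * rPlus M a := by linarith
  have hr0 : 0 < r := by linarith
  -- bounds on V and dV/dr at r
  have hVb := sepPotential_axi_near_bounds (ω := ω) hMa hadm hΛ hsNL hRx'.le hRx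
  have hVd := deriv_sepPotential_axi_near (ω := ω) hMa hadm hΛ hsNL hRx'.le hRx
  have hκ₂' : 24 * Λ / rPlus M a ^ 3 + 184 * M / rPlus M a ^ 4 ≤ horizonDerivBound M a Λ₁ := by
    unfold horizonDerivBound; gcongr
  have hVup : nearPotential M a ω Λ R x₁ t ≤ horizonDerivBound M a Λ₁ * s := by
    unfold nearPotential; rw [← hx, ← hr]
    exact hVb.2.trans (mul_le_mul_of_nonneg_right hκ₂' hs0.le)
  have hVlo : horizonSlope M a / 2 * s ≤ nearPotential M a ω Λ R x₁ t := by
    unfold nearPotential; rw [← hx, ← hr]; exact hVb.1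
  have hVpos : 0 < nearPotential M a ω Λ R x₁ t := lt_of_lt_of_le (by positivity) hVlo
  -- the lower bound on `q = Δ/(r² + a²)`
  have hs0' : 0 ≤ s * √(M ^ 2 - a ^ 2) := by positivity
  have hr4 : r ^ 2 ≤ 4 * rPlus M a ^ 2 := by
    calc r ^ 2 ≤ (2 * rPlus M a) ^ 2 := pow_le_pow_left₀ hr0.le hr2 2
      _ = 4 * rPlus M a ^ 2 := by ring
  have hq : s * √(M ^ 2 - a ^ 2) / (4 * rPlus M a ^ 2) ≤ delta M a r / (r ^ 2 + a ^ 2) := by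
    refine le_trans ?_ (delta_div_ge hMa hRx'.le)
    rw [← hs, div_le_div_iff₀ (by positivity) (by positivity)]
    exact mul_le_mul_of_nonneg_left hr4 hs0'
  refine ⟨⟨hRx', hRx⟩, hVpos, ?_, ⟨hVlo, hVup⟩, ?_⟩
  · -- the ratio: t q V_r ≥ (3/2) κ₂ s ≥ (3/2) W̃
    have ht0 : nearThreshold M a Λ₁ ≤ t := by linarith
    unfold nearPotentialDeriv
    rw [← hx, ← hr, neg_mul_eq_mul_neg, neg_neg]
    have hVr : horizonSlope M a / 2 ≤ deriv (sepPotential M a ω 0 Λ) r := hVd.1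
    have hq0 : 0 ≤ s * √(M ^ 2 - a ^ 2) / (4 * rPlus M a ^ 2) := by positivity
    have h1 : t * (horizonSlope M a / 2 * (s * √(M ^ 2 - a ^ 2) / (4 * rPlus M a ^ 2))) ≤
        t * (deriv (sepPotential M a ω 0 Λ) r * (delta M a r / (r ^ 2 + a ^ 2))) := by
      apply mul_le_mul_of_nonneg_left _ (hT₀.trans ht0)
      exact mul_le_mul hVr hq hq0 (by linarith)
    have h2 : (1 + 1 / 2) * (horizonDerivBound M a Λ₁ * s) ≤
        t * (horizonSlope M a / 2 * (s * √(M ^ 2 - a ^ 2) / (4 * rPlus M a ^ 2))) := by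
      -- uses `t ≥ T₀' = 12 κ₂ r₊² / (√ κ_H)`
      have h := ht0
      unfold nearThreshold at h
      rw [div_le_iff₀ (by positivity)] at h
      have h' := mul_le_mul_of_nonneg_right h hs0.le
      have e1 : (1 + 1 / 2) * (horizonDerivBound M a Λ₁ * s) =
          12 * horizonDerivBound M a Λ₁ * rPlus M a ^ 2 * s / (8 * rPlus M a ^ 2) := by
        field_simp
        ring
      have e2 : t * (horizonSlope M a / 2 * (s * √(M ^ 2 - a ^ 2) / (4 * rPlus M a ^ 2))) =
          t * (√(M ^ 2 - a ^ 2) * horizonSlope M a) * s / (8 * rPlus M a ^ 2) := by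
        ring
      rw [e1, e2]
      exact div_le_div_of_nonneg_right h' (by positivity)
    have h3 : (1 + 1 / 2) * nearPotential M a ω Λ R x₁ t ≤
        (1 + 1 / 2) * (horizonDerivBound M a Λ₁ * s) :=
      mul_le_mul_of_nonneg_left hVup (by norm_num)
    exact h3.trans (h2.trans h1)
  · constructor
    · have h := hR.sub_rPlus_ge hMa hxxN
      rw [hxN, add_sub_cancel_left] at h
      have e : xN - x = t - (T' - 1) := by rw [hx, hx₁]; ring
      rw [e] at h
      exact h
    · have h := hR.sub_rPlus_le hMa hxxN (by rw [hxN]; linarith)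
      rw [hxN, add_sub_cancel_left] at h
      have e : xN - x = t - (T' - 1) := by rw [hx, hx₁]; ring
      rw [e] at h
      exact h

end NearData

/-! ### The multipliers -/

/-- **Parameters of the low-frequency multipliers**: the scale `σ`, and for each end the origin
(`x₀`, `x₁`), the zone start (`T`, `T'`), the gain `ε`, the log-zone rate `p`, the soft-start and
saturation levels `u₀`, `U₁` of `KerrLowFrequencyProfiles`. [folklore] -/
structure LowFreqParams where
  /-- overall scale (`= 1/Y_F(∞)`) -/
  σ : ℝ
  /-- far origin: `t = r* − x₀` -/
  x₀ : ℝ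
  /-- far zone start -/
  T : ℝ
  /-- far gain -/
  ε : ℝ
  /-- far log-zone rate -/
  p : ℝ
  /-- far soft-start level -/
  u₀ : ℝ
  /-- far saturation level -/
  U₁ : ℝ
  /-- near origin: `t = x₁ − r*` -/
  x₁ : ℝ
  /-- near zone start -/
  T' : ℝ
  /-- near gain -/
  ε' : ℝ
  /-- near log-zone rate -/
  p' : ℝ
  /-- near soft-start level -/
  u₀' : ℝ
  /-- near saturation level -/
  U₁' : ℝ

/-- **The multipliers of Proposition 8.7.2** (DRSR arXiv:1402.7034) as a `Multipliers` record:
`f = χ₁ = 0`, `χ₂ = 1`,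
`h(r*) = σ(h_F(r* − x₀) + h_N(x₁ − r*) − 1)`, `y(r*) = σ(Y_F(r* − x₀) − Y_N(x₁ − r*))` with the
one-sided profiles of `KerrLowFrequencyProfiles` (`h_F = lowFreqCutoff p (2T)`,
`Y_F = lowFreqWeight W T ε u₀ U₁`, `W = farPotential`; `h_N`, `Y_N` likewise for
`W̃ = nearPotential`) — the printed `h`, `y + ŷ` up to the normalisation `y(∞) = 1`.
[cite: DafermosRodnianskiShlapentokhrothman2014, Prop. 8.7.2] -/
def axiLowFreqMultipliers (M a ω Λ : ℝ) (R : ℝ → ℝ) (P : LowFreqParams) : Multipliers where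
  f := 0
  f' := 0
  f'' := 0
  f''' := 0
  h := fun x ↦ P.σ * (lowFreqCutoff P.p (2 * P.T) (x - P.x₀) +
    lowFreqCutoff P.p' (2 * P.T') (P.x₁ - x) - 1)
  h' := fun x ↦ P.σ * (lowFreqCutoff₁ P.p (2 * P.T) (x - P.x₀) -
    lowFreqCutoff₁ P.p' (2 * P.T') (P.x₁ - x))
  h'' := fun x ↦ P.σ * (lowFreqCutoff₂ P.p (2 * P.T) (x - P.x₀) +
    lowFreqCutoff₂ P.p' (2 * P.T') (P.x₁ - x))
  y := fun x ↦ P.σ * (lowFreqWeight (farPotential M a ω Λ R P.x₀) P.T P.ε P.u₀ P.U₁ (x - P.x₀) -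
    lowFreqWeight (nearPotential M a ω Λ R P.x₁) P.T' P.ε' P.u₀' P.U₁' (P.x₁ - x))
  y' := fun x ↦ P.σ *
    (lowFreqWeightDeriv (farPotential M a ω Λ R P.x₀) (farPotentialDeriv M a ω Λ R P.x₀)
        P.T P.ε P.u₀ P.U₁ (x - P.x₀) +
      lowFreqWeightDeriv (nearPotential M a ω Λ R P.x₁) (nearPotentialDeriv M a ω Λ R P.x₁)
        P.T' P.ε' P.u₀' P.U₁' (P.x₁ - x))
  χ₁ := 0
  χ₁' := 0
  χ₂ := 1
  χ₂' := 0

/-- **Validity of the parameters**: the inequalities under which the profiles are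
differentiable (`T, T' > 1`, `p, p', u₀, u₀' > 0`, `u₀ ≤ U₁`, `u₀' ≤ U₁'`, and the positivity and
decay `(3/2)W ≤ −tW'` of the one-sided potentials on their zones). [folklore] -/
structure LowFreqParams.Valid (M a ω Λ : ℝ) (R : ℝ → ℝ) (P : LowFreqParams) : Prop where
  T_gt : 1 < P.T
  T'_gt : 1 < P.T'
  p_pos : 0 < P.p
  p'_pos : 0 < P.p'
  u₀_pos : 0 < P.u₀
  u₀'_pos : 0 < P.u₀'
  U₁_ge : P.u₀ ≤ P.U₁
  U₁'_ge : P.u₀' ≤ P.U₁'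
  far_pos : ∀ t, P.T - 1 ≤ t → 0 < farPotential M a ω Λ R P.x₀ t
  far_dec : ∀ t, P.T - 1 ≤ t →
    (1 + 1 / 2) * farPotential M a ω Λ R P.x₀ t ≤ -(t * farPotentialDeriv M a ω Λ R P.x₀ t)
  near_pos : ∀ t, P.T' - 1 ≤ t → 0 < nearPotential M a ω Λ R P.x₁ t
  near_dec : ∀ t, P.T' - 1 ≤ t →
    (1 + 1 / 2) * nearPotential M a ω Λ R P.x₁ t ≤ -(t * nearPotentialDeriv M a ω Λ R P.x₁ t)

section Multipliers

variable {M a ω Λ : ℝ} {R : ℝ → ℝ} {P : LowFreqParams}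

/-- **The multipliers are differentiable** with the derivative fields of the record.
[folklore] -/
theorem hasDerivs_axiLowFreqMultipliers (hMa : IsSubextremal M a) (hR : IsTortoiseRadius M a R)
    (hP : P.Valid M a ω Λ R) : (axiLowFreqMultipliers M a ω Λ R P).HasDerivs where
  df := fun x ↦ hasDerivAt_const x _
  df' := fun x ↦ hasDerivAt_const x _
  df'' := fun x ↦ hasDerivAt_const x _
  dh := fun x ↦ by
    have hT : 0 < 2 * P.T := by linarith [hP.T_gt]
    have hT' : 0 < 2 * P.T' := by linarith [hP.T'_gt]
    have h1 := (hasDerivAt_lowFreqCutoff hT hP.p_pos (x - P.x₀)).comp_sub_const x P.x₀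
    have h2 := (hasDerivAt_lowFreqCutoff hT' hP.p'_pos (P.x₁ - x)).comp_const_sub P.x₁ x
    have h := ((h1.add h2).sub_const 1).const_mul P.σ
    refine h.congr_deriv ?_
    simp only [axiLowFreqMultipliers]
    ring
  dh' := fun x ↦ by
    have hT : 0 < 2 * P.T := by linarith [hP.T_gt]
    have hT' : 0 < 2 * P.T' := by linarith [hP.T'_gt]
    have h1 := (hasDerivAt_lowFreqCutoff₁ hT hP.p_pos (x - P.x₀)).comp_sub_const x P.x₀
    have h2 := (hasDerivAt_lowFreqCutoff₁ hT' hP.p'_pos (P.x₁ - x)).comp_const_sub P.x₁ x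
    have h := (h1.sub h2).const_mul P.σ
    refine h.congr_deriv ?_
    simp only [axiLowFreqMultipliers]
    ring
  dy := fun x ↦ by
    have h1 := (hasDerivAt_lowFreqWeight (W := farPotential M a ω Λ R P.x₀)
      (W₁ := farPotentialDeriv M a ω Λ R P.x₀) (ε := P.ε) hP.T_gt (by norm_num : (0 : ℝ) ≤ 1 / 2)
      (fun t _ ↦ hasDerivAt_farPotential hR hMa P.x₀ t) hP.far_pos hP.far_dec hP.u₀_pos
      (hP.u₀_pos.le.trans hP.U₁_ge) (x - P.x₀)).comp_sub_const x P.x₀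
    have h2 := (hasDerivAt_lowFreqWeight (W := nearPotential M a ω Λ R P.x₁)
      (W₁ := nearPotentialDeriv M a ω Λ R P.x₁) (ε := P.ε') hP.T'_gt (by norm_num : (0 : ℝ) ≤ 1 / 2)
      (fun t _ ↦ hasDerivAt_nearPotential hR hMa P.x₁ t) hP.near_pos hP.near_dec hP.u₀'_pos
      (hP.u₀'_pos.le.trans hP.U₁'_ge) (P.x₁ - x)).comp_const_sub P.x₁ x
    have h := (h1.sub h2).const_mul P.σ
    refine h.congr_deriv ?_
    simp only [axiLowFreqMultipliers]
    ring
  dχ₁ := fun x ↦ hasDerivAt_const x _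
  dχ₂ := fun x ↦ hasDerivAt_const x _

end Multipliers

/-! ### Zone values of the multipliers -/

section Zones

variable {M a ω Λ : ℝ} {R : ℝ → ℝ} {P : LowFreqParams}

/-- Left of the far zone (`r* − x₀ ≤ T − 1`) the far profiles are trivial:
`Y_F = Y_F' = 0`, `h_F = 1`, `h_F' = h_F'' = 0`. [folklore] -/
theorem axiLowFreq_far_trivial (hP : P.Valid M a ω Λ R) {x : ℝ} (hx : x - P.x₀ ≤ P.T - 1) :
    lowFreqWeight (farPotential M a ω Λ R P.x₀) P.T P.ε P.u₀ P.U₁ (x - P.x₀) = 0 ∧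
      lowFreqWeightDeriv (farPotential M a ω Λ R P.x₀) (farPotentialDeriv M a ω Λ R P.x₀)
        P.T P.ε P.u₀ P.U₁ (x - P.x₀) = 0 ∧
      lowFreqCutoff P.p (2 * P.T) (x - P.x₀) = 1 ∧ lowFreqCutoff₁ P.p (2 * P.T) (x - P.x₀) = 0 ∧
      lowFreqCutoff₂ P.p (2 * P.T) (x - P.x₀) = 0 := by
  have hT : 0 < 2 * P.T := by linarith [hP.T_gt]
  have hle : x - P.x₀ ≤ 2 * P.T := by linarith [hP.T_gt]
  have hw := lowFreqWeight_of_le (W := farPotential M a ω Λ R P.x₀)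
    (W₁ := farPotentialDeriv M a ω Λ R P.x₀) (T := P.T) (ε := P.ε) hP.u₀_pos
    (hP.u₀_pos.le.trans hP.U₁_ge) hx
  exact ⟨hw.1, hw.2, lowFreqCutoff_eq_one hT hle, lowFreqCutoff₁_eq_zero_of_le hT hle,
    lowFreqCutoff₂_eq_zero_of_le hT hle⟩

/-- Right of the near zone (`x₁ − r* ≤ T' − 1`) the near profiles are trivial. [folklore] -/
theorem axiLowFreq_near_trivial (hP : P.Valid M a ω Λ R) {x : ℝ} (hx : P.x₁ - x ≤ P.T' - 1) :
    lowFreqWeight (nearPotential M a ω Λ R P.x₁) P.T' P.ε' P.u₀' P.U₁' (P.x₁ - x) = 0 ∧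
      lowFreqWeightDeriv (nearPotential M a ω Λ R P.x₁) (nearPotentialDeriv M a ω Λ R P.x₁)
        P.T' P.ε' P.u₀' P.U₁' (P.x₁ - x) = 0 ∧
      lowFreqCutoff P.p' (2 * P.T') (P.x₁ - x) = 1 ∧
      lowFreqCutoff₁ P.p' (2 * P.T') (P.x₁ - x) = 0 ∧
      lowFreqCutoff₂ P.p' (2 * P.T') (P.x₁ - x) = 0 := by
  have hT : 0 < 2 * P.T' := by linarith [hP.T'_gt]
  have hle : P.x₁ - x ≤ 2 * P.T' := by linarith [hP.T'_gt]
  have hw := lowFreqWeight_of_le (W := nearPotential M a ω Λ R P.x₁)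
    (W₁ := nearPotentialDeriv M a ω Λ R P.x₁) (T := P.T') (ε := P.ε') hP.u₀'_pos
    (hP.u₀'_pos.le.trans hP.U₁'_ge) hx
  exact ⟨hw.1, hw.2, lowFreqCutoff_eq_one hT hle, lowFreqCutoff₁_eq_zero_of_le hT hle,
    lowFreqCutoff₂_eq_zero_of_le hT hle⟩

/-- On `x₁ − r* ≤ T' − 1` (far zone and middle) the multipliers are the scaled far profiles.
[folklore] -/
theorem axiLowFreq_eq_far (hP : P.Valid M a ω Λ R) {x : ℝ} (hx : P.x₁ - x ≤ P.T' - 1) :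
    (axiLowFreqMultipliers M a ω Λ R P).h x = P.σ * lowFreqCutoff P.p (2 * P.T) (x - P.x₀) ∧
      (axiLowFreqMultipliers M a ω Λ R P).h' x = P.σ * lowFreqCutoff₁ P.p (2 * P.T) (x - P.x₀) ∧
      (axiLowFreqMultipliers M a ω Λ R P).h'' x = P.σ * lowFreqCutoff₂ P.p (2 * P.T) (x - P.x₀) ∧
      (axiLowFreqMultipliers M a ω Λ R P).y x =
        P.σ * lowFreqWeight (farPotential M a ω Λ R P.x₀) P.T P.ε P.u₀ P.U₁ (x - P.x₀) ∧
      (axiLowFreqMultipliers M a ω Λ R P).y' x =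
        P.σ * lowFreqWeightDeriv (farPotential M a ω Λ R P.x₀) (farPotentialDeriv M a ω Λ R P.x₀)
          P.T P.ε P.u₀ P.U₁ (x - P.x₀) := by
  obtain ⟨h1, h2, h3, h4, h5⟩ := axiLowFreq_near_trivial hP hx
  simp only [axiLowFreqMultipliers, h1, h2, h3, h4, h5]
  refine ⟨by ring, by ring, by ring, by ring, by ring⟩

/-- On `r* − x₀ ≤ T − 1` (near zone and middle) the multipliers are the scaled (reflected) near
profiles. [folklore] -/
theorem axiLowFreq_eq_near (hP : P.Valid M a ω Λ R) {x : ℝ} (hx : x - P.x₀ ≤ P.T - 1) :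
    (axiLowFreqMultipliers M a ω Λ R P).h x = P.σ * lowFreqCutoff P.p' (2 * P.T') (P.x₁ - x) ∧
      (axiLowFreqMultipliers M a ω Λ R P).h' x =
        -(P.σ * lowFreqCutoff₁ P.p' (2 * P.T') (P.x₁ - x)) ∧
      (axiLowFreqMultipliers M a ω Λ R P).h'' x =
        P.σ * lowFreqCutoff₂ P.p' (2 * P.T') (P.x₁ - x) ∧
      (axiLowFreqMultipliers M a ω Λ R P).y x =
        -(P.σ * lowFreqWeight (nearPotential M a ω Λ R P.x₁) P.T' P.ε' P.u₀' P.U₁' (P.x₁ - x)) ∧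
      (axiLowFreqMultipliers M a ω Λ R P).y' x =
        P.σ * lowFreqWeightDeriv (nearPotential M a ω Λ R P.x₁) (nearPotentialDeriv M a ω Λ R P.x₁)
          P.T' P.ε' P.u₀' P.U₁' (P.x₁ - x) := by
  obtain ⟨h1, h2, h3, h4, h5⟩ := axiLowFreq_far_trivial hP hx
  simp only [axiLowFreqMultipliers, h1, h2, h3, h4, h5]
  refine ⟨by ring, by ring, by ring, by ring, by ring⟩

/-- In the middle (`x₁ − T' + 1 ≤ r* ≤ x₀ + T − 1`): `h = σ`, `h' = h'' = 0`, `y = y' = 0`.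
[folklore] -/
theorem axiLowFreq_eq_mid (hP : P.Valid M a ω Λ R) {x : ℝ} (hx₁ : P.x₁ - x ≤ P.T' - 1)
    (hx₀ : x - P.x₀ ≤ P.T - 1) :
    (axiLowFreqMultipliers M a ω Λ R P).h x = P.σ ∧ (axiLowFreqMultipliers M a ω Λ R P).h' x = 0 ∧
      (axiLowFreqMultipliers M a ω Λ R P).h'' x = 0 ∧ (axiLowFreqMultipliers M a ω Λ R P).y x = 0 ∧
      (axiLowFreqMultipliers M a ω Λ R P).y' x = 0 := by
  obtain ⟨h1, h2, h3, h4, h5⟩ := axiLowFreq_eq_far hP hx₁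
  obtain ⟨g1, g2, g3, g4, g5⟩ := axiLowFreq_far_trivial hP hx₀
  rw [h1, h2, h3, h4, h5, g1, g2, g3, g4, g5]
  simp

/-- `0 ≤ h ≤ σ` and `|y| ≤ σ·max(Y_F(∞), Y_N(∞))` everywhere (`σ ≥ 0`, zones separated:
`x₁ − T' + 1 ≤ x₀ + T − 1`). [folklore] -/
theorem axiLowFreq_bounds (hP : P.Valid M a ω Λ R) (hσ : 0 ≤ P.σ) (hε : 0 ≤ P.ε) (hε' : 0 ≤ P.ε')
    (hzone : P.x₁ - (P.T' - 1) ≤ P.x₀ + (P.T - 1)) (x : ℝ) :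
    (0 ≤ (axiLowFreqMultipliers M a ω Λ R P).h x ∧ (axiLowFreqMultipliers M a ω Λ R P).h x ≤ P.σ) ∧
      |(axiLowFreqMultipliers M a ω Λ R P).y x| ≤
        P.σ * max (lowFreqTop P.ε P.u₀ P.U₁) (lowFreqTop P.ε' P.u₀' P.U₁') := by
  rcases le_or_gt (P.x₁ - x) (P.T' - 1) with h | h
  · obtain ⟨h1, -, -, h4, -⟩ := axiLowFreq_eq_far hP h
    rw [h1, h4]
    have hc := lowFreqCutoff_mem_Icc P.p (2 * P.T) (x - P.x₀)
    have hw := lowFreqWeight_mem_Icc (W := farPotential M a ω Λ R P.x₀) (T := P.T) hε hP.u₀_pos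
      hP.U₁_ge (x - P.x₀)
    refine ⟨⟨mul_nonneg hσ hc.1, mul_le_of_le_one_right hσ hc.2⟩, ?_⟩
    rw [abs_mul, abs_of_nonneg hσ, abs_of_nonneg hw.1]
    exact mul_le_mul_of_nonneg_left (hw.2.trans (le_max_left _ _)) hσ
  · have h' : x - P.x₀ ≤ P.T - 1 := by linarith
    obtain ⟨h1, -, -, h4, -⟩ := axiLowFreq_eq_near hP h'
    rw [h1, h4]
    have hc := lowFreqCutoff_mem_Icc P.p' (2 * P.T') (P.x₁ - x)
    have hw := lowFreqWeight_mem_Icc (W := nearPotential M a ω Λ R P.x₁) (T := P.T') hε'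
      hP.u₀'_pos hP.U₁'_ge (P.x₁ - x)
    refine ⟨⟨mul_nonneg hσ hc.1, mul_le_of_le_one_right hσ hc.2⟩, ?_⟩
    rw [abs_neg, abs_mul, abs_of_nonneg hσ, abs_of_nonneg hw.1]
    exact mul_le_mul_of_nonneg_left (hw.2.trans (le_max_right _ _)) hσ

end Zones

/-! ### The bulk: identity and non-negativity -/

section Bulk

variable {M a ω Λ E : ℝ} {R : ℝ → ℝ} {P : LowFreqParams} {V V' : ℝ → ℝ} {u u₁ : ℝ → ℂ}

/-- The bulk of `Ϙ^h + ϟ^y − EQ^T` (`f = 0`, `χ₂ = 1`, `χ₁ = 0`):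
`(h + y')|u'|² + (h(V − ω²) − ½h'' + y'(ω² − V) − yV')|u|²` — (axisym2)/(axisym3) of DRSR
arXiv:1402.7034. [cite: DafermosRodnianskiShlapentokhrothman2014, Prop. 8.7.1 (proof)] -/
theorem combinedBulk_axiLowFreq (x : ℝ) :
    combinedBulk ω ω E V V' (axiLowFreqMultipliers M a ω Λ R P) u u₁ x =
      ((axiLowFreqMultipliers M a ω Λ R P).h x + (axiLowFreqMultipliers M a ω Λ R P).y' x) *
          ‖u₁ x‖ ^ 2 +
        ((axiLowFreqMultipliers M a ω Λ R P).h x * (V x - ω ^ 2) -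
            1 / 2 * (axiLowFreqMultipliers M a ω Λ R P).h'' x +
            (axiLowFreqMultipliers M a ω Λ R P).y' x * (ω ^ 2 - V x) -
            (axiLowFreqMultipliers M a ω Λ R P).y x * V' x) * ‖u x‖ ^ 2 := by
  simp only [combinedBulk, axiLowFreqMultipliers, Pi.zero_apply]
  ring

/-- **The hypotheses of the one-sided coefficient inequality, far and near**, bundled.
[folklore] -/
structure LowFreqParams.Coeff (M a ω Λ : ℝ) (R : ℝ → ℝ) (P : LowFreqParams) (D₁ D₂ : ℝ) :
    Prop where
  ε_pos : 0 < P.ε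
  ε'_pos : 0 < P.ε'
  p_le : P.p ≤ 1
  p'_le : P.p' ≤ 1
  pε : P.p * (D₁ + D₂) ≤ 2 * P.ε
  pε' : P.p' * (D₁ + D₂) ≤ 2 * P.ε'
  εK : 5 * P.ε ≤ P.T * farPotential M a ω Λ R P.x₀ P.T
  εK' : 5 * P.ε' ≤ P.T' * nearPotential M a ω Λ R P.x₁ P.T'
  u₀_eq : P.u₀ = 1 / 2 / (4 * P.T * farPotential M a ω Λ R P.x₀ P.T)
  u₀'_eq : P.u₀' = 1 / 2 / (4 * P.T' * nearPotential M a ω Λ R P.x₁ P.T')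
  U₁_ge : lowFreqF (farPotential M a ω Λ R P.x₀) P.T (2 * P.T * Real.exp (1 / P.p)) ≤ P.U₁
  U₁'_ge : lowFreqF (nearPotential M a ω Λ R P.x₁) P.T' (2 * P.T' * Real.exp (1 / P.p')) ≤ P.U₁'
  ω_far : ω ^ 2 ≤ farPotential M a ω Λ R P.x₀ (2 * P.T * Real.exp (1 / P.p))
  ω_near : ω ^ 2 ≤ nearPotential M a ω Λ R P.x₁ (2 * P.T' * Real.exp (1 / P.p'))
  zone : P.x₁ - (P.T' - 1) ≤ P.x₀ + (P.T - 1)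
  ω_mid : ∀ x, P.x₁ - (P.T' - 1) ≤ x → x ≤ P.x₀ + (P.T - 1) → ω ^ 2 ≤ sepPotential M a ω 0 Λ (R x)

/-- **The bulk is non-negative everywhere** (DRSR arXiv:1402.7034, proof of Prop. 8.7.1: "the
integrand of the left hand side of (axisym3) is non-negative"), and in the middle it is
`σ(|u'|² + (V − ω²)|u|²)`. [cite: DafermosRodnianskiShlapentokhrothman2014, Prop. 8.7.1 (proof)] -/
theorem combinedBulk_axiLowFreq_nonneg {D₁ D₂ : ℝ} (hMa : IsSubextremal M a)
    (hR : IsTortoiseRadius M a R) (hP : P.Valid M a ω Λ R) (hC : P.Coeff M a ω Λ R D₁ D₂)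
    (hσ : 0 ≤ P.σ) (hD₁ : ∀ s, |sharpBump₁ s| ≤ D₁) (hD₂ : ∀ s, |sharpBump₂ s| ≤ D₂) (x : ℝ) :
    0 ≤ combinedBulk ω ω E (fun x ↦ sepPotential M a ω 0 Λ (R x))
      (fun x ↦ deriv (sepPotential M a ω 0 Λ) (R x) * (delta M a (R x) / (R x ^ 2 + a ^ 2)))
      (axiLowFreqMultipliers M a ω Λ R P) u u₁ x ∧
    (P.x₁ - (P.T' - 1) ≤ x → x ≤ P.x₀ + (P.T - 1) →
      combinedBulk ω ω E (fun x ↦ sepPotential M a ω 0 Λ (R x))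
        (fun x ↦ deriv (sepPotential M a ω 0 Λ) (R x) * (delta M a (R x) / (R x ^ 2 + a ^ 2)))
        (axiLowFreqMultipliers M a ω Λ R P) u u₁ x =
      P.σ * (‖u₁ x‖ ^ 2 + (sepPotential M a ω 0 Λ (R x) - ω ^ 2) * ‖u x‖ ^ 2)) := by
  rw [combinedBulk_axiLowFreq]
  have hc : (0 : ℝ) < 1 / 2 := by norm_num
  have hc1 : (1 / 2 : ℝ) ≤ 1 := by norm_num
  constructor
  · rcases le_or_gt (P.x₁ - x) (P.T' - 1) with h₁ | h₁
    · -- far zone or middle: far profiles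
      obtain ⟨e1, -, e3, e4, e5⟩ := axiLowFreq_eq_far hP h₁
      rw [e1, e3, e4, e5]
      rcases le_or_gt (P.T - 1) (x - P.x₀) with h₂ | h₂
      · -- far zone proper: the one-sided lemma with `W = farPotential`
        have hco := lowFreq_coeff_nonneg (W := farPotential M a ω Λ R P.x₀)
          (W₁ := farPotentialDeriv M a ω Λ R P.x₀) (ϖ := ω) hP.T_gt hc hc1 hC.ε_pos hP.p_pos
          hC.p_le hD₁ hD₂ hC.pε (fun t _ ↦ hasDerivAt_farPotential hR hMa P.x₀ t) hP.far_pos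
          hP.far_dec hC.εK hC.u₀_eq hC.U₁_ge hC.ω_far h₂
        have hY' := lowFreqWeightDeriv_nonneg (W := farPotential M a ω Λ R P.x₀)
          (W₁ := farPotentialDeriv M a ω Λ R P.x₀) (ε := P.ε) hc.le hC.ε_pos.le hP.far_pos
          hP.far_dec hP.u₀_pos hP.U₁_ge (x - P.x₀)
        have hh := (lowFreqCutoff_mem_Icc P.p (2 * P.T) (x - P.x₀)).1
        have eW : farPotential M a ω Λ R P.x₀ (x - P.x₀) = sepPotential M a ω 0 Λ (R x) := by
          simp [farPotential]
        have eW₁ : farPotentialDeriv M a ω Λ R P.x₀ (x - P.x₀) =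
            deriv (sepPotential M a ω 0 Λ) (R x) * (delta M a (R x) / (R x ^ 2 + a ^ 2)) := by
          simp [farPotentialDeriv]
        rw [eW, eW₁] at hco
        have e : ∀ A B C D : ℝ,
            (P.σ * A + P.σ * B) * ‖u₁ x‖ ^ 2 + (P.σ * A * (sepPotential M a ω 0 Λ (R x) - ω ^ 2) -
              1 / 2 * (P.σ * C) + P.σ * B * (ω ^ 2 - sepPotential M a ω 0 Λ (R x)) -
              P.σ * D * (deriv (sepPotential M a ω 0 Λ) (R x) *
                (delta M a (R x) / (R x ^ 2 + a ^ 2)))) * ‖u x‖ ^ 2 =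
            P.σ * ((A + B) * ‖u₁ x‖ ^ 2 + (A * (sepPotential M a ω 0 Λ (R x) - ω ^ 2) -
              1 / 2 * C + B * (ω ^ 2 - sepPotential M a ω 0 Λ (R x)) -
              D * (deriv (sepPotential M a ω 0 Λ) (R x) *
                (delta M a (R x) / (R x ^ 2 + a ^ 2)))) * ‖u x‖ ^ 2) := fun A B C D ↦ by ring
        rw [e]
        exact mul_nonneg hσ (add_nonneg (mul_nonneg (add_nonneg hh hY') (sq_nonneg _))
          (mul_nonneg hco (sq_nonneg _)))
      · -- middle
        obtain ⟨g1, g2, -, -, g5⟩ := axiLowFreq_far_trivial hP h₂.le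
        rw [g1, g2, show lowFreqCutoff P.p (2 * P.T) (x - P.x₀) = 1 from
          (axiLowFreq_far_trivial hP h₂.le).2.2.1, g5]
        have hω := hC.ω_mid x (by linarith) (by linarith)
        have e : (P.σ * 1 + P.σ * 0) * ‖u₁ x‖ ^ 2 + (P.σ * 1 * (sepPotential M a ω 0 Λ (R x) - ω ^ 2) -
            1 / 2 * (P.σ * 0) + P.σ * 0 * (ω ^ 2 - sepPotential M a ω 0 Λ (R x)) -
            P.σ * 0 * (deriv (sepPotential M a ω 0 Λ) (R x) * (delta M a (R x) / (R x ^ 2 + a ^ 2)))) *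
            ‖u x‖ ^ 2 = P.σ * (‖u₁ x‖ ^ 2 + (sepPotential M a ω 0 Λ (R x) - ω ^ 2) * ‖u x‖ ^ 2) := by
          ring
        rw [e]
        exact mul_nonneg hσ (add_nonneg (sq_nonneg _) (mul_nonneg (sub_nonneg.2 hω) (sq_nonneg _)))
    · -- near zone proper: the one-sided lemma with `W = nearPotential`, reflected
      have h₀ : x - P.x₀ ≤ P.T - 1 := by linarith [hC.zone]
      obtain ⟨e1, -, e3, e4, e5⟩ := axiLowFreq_eq_near hP h₀
      rw [e1, e3, e4, e5]
      have hco := lowFreq_coeff_nonneg (W := nearPotential M a ω Λ R P.x₁)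
        (W₁ := nearPotentialDeriv M a ω Λ R P.x₁) (ϖ := ω) hP.T'_gt hc hc1 hC.ε'_pos hP.p'_pos
        hC.p'_le hD₁ hD₂ hC.pε' (fun t _ ↦ hasDerivAt_nearPotential hR hMa P.x₁ t) hP.near_pos
        hP.near_dec hC.εK' hC.u₀'_eq hC.U₁'_ge hC.ω_near h₁.le
      have hY' := lowFreqWeightDeriv_nonneg (W := nearPotential M a ω Λ R P.x₁)
        (W₁ := nearPotentialDeriv M a ω Λ R P.x₁) (ε := P.ε') hc.le hC.ε'_pos.le hP.near_pos
        hP.near_dec hP.u₀'_pos hP.U₁'_ge (P.x₁ - x)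
      have hh := (lowFreqCutoff_mem_Icc P.p' (2 * P.T') (P.x₁ - x)).1
      have eW : nearPotential M a ω Λ R P.x₁ (P.x₁ - x) = sepPotential M a ω 0 Λ (R x) := by
        simp [nearPotential]
      have eW₁ : nearPotentialDeriv M a ω Λ R P.x₁ (P.x₁ - x) =
          -(deriv (sepPotential M a ω 0 Λ) (R x) * (delta M a (R x) / (R x ^ 2 + a ^ 2))) := by
        simp [nearPotentialDeriv]
      rw [eW, eW₁] at hco
      have e : ∀ A B C D : ℝ,
          (P.σ * A + P.σ * B) * ‖u₁ x‖ ^ 2 + (P.σ * A * (sepPotential M a ω 0 Λ (R x) - ω ^ 2) -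
            1 / 2 * (P.σ * C) + P.σ * B * (ω ^ 2 - sepPotential M a ω 0 Λ (R x)) -
            -(P.σ * D) * (deriv (sepPotential M a ω 0 Λ) (R x) *
              (delta M a (R x) / (R x ^ 2 + a ^ 2)))) * ‖u x‖ ^ 2 =
          P.σ * ((A + B) * ‖u₁ x‖ ^ 2 + (A * (sepPotential M a ω 0 Λ (R x) - ω ^ 2) -
            1 / 2 * C + B * (ω ^ 2 - sepPotential M a ω 0 Λ (R x)) -
            D * -(deriv (sepPotential M a ω 0 Λ) (R x) *
              (delta M a (R x) / (R x ^ 2 + a ^ 2)))) * ‖u x‖ ^ 2) := fun A B C D ↦ by ring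
      rw [e]
      exact mul_nonneg hσ (add_nonneg (mul_nonneg (add_nonneg hh hY') (sq_nonneg _))
        (mul_nonneg hco (sq_nonneg _)))
  · intro hx₁ hx₀
    obtain ⟨e1, -, e3, e4, e5⟩ := axiLowFreq_eq_mid hP (x := x) (by linarith) (by linarith)
    rw [e1, e3, e4, e5]
    ring

end Bulk

/-! ### End limits and integrability of the source -/

section Limits

variable {M a ω Λ E : ℝ} {R : ℝ → ℝ} {P : LowFreqParams} {u u₁ H : ℝ → ℂ}

/-- **End limits at `r* = ∞`**: `h → 0`, `h' → 0` (eventually `0`), `y → σY_F(∞)` (eventually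
equal, once `F ≥ U₁ + 1`), `f = 0`, `χ₁ = 0`, `χ₂ = 1` ("`y = 1, h = 0, ŷ = 0` for `r* ≥ R*_∞`").
[cite: DafermosRodnianskiShlapentokhrothman2014, Prop. 8.7.2] -/
theorem endLimits_axiLowFreq_atTop (hP : P.Valid M a ω Λ R) (hzone : P.x₁ - (P.T' - 1) ≤ P.x₀ + (P.T - 1))
    {Ts : ℝ} (hTs : P.T ≤ Ts)
    (hsat : ∀ t, Ts ≤ t → P.U₁ + 1 ≤ lowFreqF (farPotential M a ω Λ R P.x₀) P.T t) :
    (axiLowFreqMultipliers M a ω Λ R P).EndLimits atTop 0 (P.σ * lowFreqTop P.ε P.u₀ P.U₁) 0 1 := by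
  have hT : 0 < 2 * P.T := by linarith [hP.T_gt]
  have hexp : 1 ≤ Real.exp (1 / P.p) := Real.one_le_exp (one_div_pos.2 hP.p_pos).le
  set X := max (P.x₀ + 2 * P.T * Real.exp (1 / P.p)) (P.x₀ + Ts) with hX
  have hfar : ∀ x, X ≤ x → P.x₁ - x ≤ P.T' - 1 := fun x hx ↦ by
    have : P.x₀ + (P.T - 1) ≤ x := by
      have h1 : P.x₀ + 2 * P.T * Real.exp (1 / P.p) ≤ x := (le_max_left _ _).trans hx
      nlinarith [hP.T_gt]
    linarith
  have hh : ∀ x, X ≤ x → (axiLowFreqMultipliers M a ω Λ R P).h x = 0 ∧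
      (axiLowFreqMultipliers M a ω Λ R P).h' x = 0 := fun x hx ↦ by
    obtain ⟨e1, e2, -, -, -⟩ := axiLowFreq_eq_far hP (hfar x hx)
    have hx' : 2 * P.T * Real.exp (1 / P.p) ≤ x - P.x₀ := by
      have := (le_max_left _ _).trans hx; linarith
    rw [e1, e2, lowFreqCutoff_eq_zero hT hP.p_pos hx', lowFreqCutoff₁_eq_zero_of_ge hT hP.p_pos hx']
    simp
  have hy : ∀ x, X ≤ x → (axiLowFreqMultipliers M a ω Λ R P).y x =
      P.σ * lowFreqTop P.ε P.u₀ P.U₁ := fun x hx ↦ by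
    obtain ⟨-, -, -, e4, -⟩ := axiLowFreq_eq_far hP (hfar x hx)
    have hx' : Ts ≤ x - P.x₀ := by have := (le_max_right _ _).trans hx; linarith
    rw [e4, lowFreqWeight_eq_top hP.u₀_pos hP.U₁_ge (hTs.trans hx') (hsat _ hx')]
  refine ⟨tendsto_const_nhds, ⟨0, tendsto_const_nhds⟩, tendsto_const_nhds, ⟨0, ?_⟩, ?_, ?_,
    tendsto_const_nhds, tendsto_const_nhds⟩
  · exact tendsto_const_nhds.congr' (by
      filter_upwards [eventually_ge_atTop X] with x hx using ((hh x hx).1).symm)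
  · exact tendsto_const_nhds.congr' (by
      filter_upwards [eventually_ge_atTop X] with x hx using ((hh x hx).2).symm)
  · exact tendsto_const_nhds.congr' (by
      filter_upwards [eventually_ge_atTop X] with x hx using (hy x hx).symm)

/-- **End limits at the horizon end `r* = −∞`**: `h → 0`, `h' → 0`, `y → −σY_N(∞)`.
[cite: DafermosRodnianskiShlapentokhrothman2014, Prop. 8.7.2] -/
theorem endLimits_axiLowFreq_atBot (hP : P.Valid M a ω Λ R) (hzone : P.x₁ - (P.T' - 1) ≤ P.x₀ + (P.T - 1))
    {Ts' : ℝ} (hTs' : P.T' ≤ Ts')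
    (hsat' : ∀ t, Ts' ≤ t → P.U₁' + 1 ≤ lowFreqF (nearPotential M a ω Λ R P.x₁) P.T' t) :
    (axiLowFreqMultipliers M a ω Λ R P).EndLimits atBot 0 (-(P.σ * lowFreqTop P.ε' P.u₀' P.U₁'))
      0 1 := by
  have hT : 0 < 2 * P.T' := by linarith [hP.T'_gt]
  have hexp : 1 ≤ Real.exp (1 / P.p') := Real.one_le_exp (one_div_pos.2 hP.p'_pos).le
  set X := min (P.x₁ - 2 * P.T' * Real.exp (1 / P.p')) (P.x₁ - Ts') with hX
  have hnear : ∀ x, x ≤ X → x - P.x₀ ≤ P.T - 1 := fun x hx ↦ by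
    have : x ≤ P.x₁ - (P.T' - 1) := by
      have h1 : x ≤ P.x₁ - 2 * P.T' * Real.exp (1 / P.p') := hx.trans (min_le_left _ _)
      nlinarith [hP.T'_gt]
    linarith
  have hh : ∀ x, x ≤ X → (axiLowFreqMultipliers M a ω Λ R P).h x = 0 ∧
      (axiLowFreqMultipliers M a ω Λ R P).h' x = 0 := fun x hx ↦ by
    obtain ⟨e1, e2, -, -, -⟩ := axiLowFreq_eq_near hP (hnear x hx)
    have hx' : 2 * P.T' * Real.exp (1 / P.p') ≤ P.x₁ - x := by
      have := hx.trans (min_le_left _ _); linarith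
    rw [e1, e2, lowFreqCutoff_eq_zero hT hP.p'_pos hx', lowFreqCutoff₁_eq_zero_of_ge hT hP.p'_pos hx']
    simp
  have hy : ∀ x, x ≤ X → (axiLowFreqMultipliers M a ω Λ R P).y x =
      -(P.σ * lowFreqTop P.ε' P.u₀' P.U₁') := fun x hx ↦ by
    obtain ⟨-, -, -, e4, -⟩ := axiLowFreq_eq_near hP (hnear x hx)
    have hx' : Ts' ≤ P.x₁ - x := by have := hx.trans (min_le_right _ _); linarith
    rw [e4, lowFreqWeight_eq_top hP.u₀'_pos hP.U₁'_ge (hTs'.trans hx') (hsat' _ hx')]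
  refine ⟨tendsto_const_nhds, ⟨0, tendsto_const_nhds⟩, tendsto_const_nhds, ⟨0, ?_⟩, ?_, ?_,
    tendsto_const_nhds, tendsto_const_nhds⟩
  · exact tendsto_const_nhds.congr' (by
      filter_upwards [eventually_le_atBot X] with x hx using ((hh x hx).1).symm)
  · exact tendsto_const_nhds.congr' (by
      filter_upwards [eventually_le_atBot X] with x hx using ((hh x hx).2).symm)
  · exact tendsto_const_nhds.congr' (by
      filter_upwards [eventually_le_atBot X] with x hx using (hy x hx).symm)

/-- The source term of `Ϙ^h + ϟ^y − EQ^T`: `−h Re(uH̄) − 2y Re(u'H̄) + Eω Im(Hū)`.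
[cite: DafermosRodnianskiShlapentokhrothman2014, Prop. 8.7.2] -/
theorem combinedSource_axiLowFreq (x : ℝ) :
    combinedSource ω ω E (axiLowFreqMultipliers M a ω Λ R P) u u₁ H x =
      -((axiLowFreqMultipliers M a ω Λ R P).h x * ⟪H x, u x⟫_ℝ) -
        2 * (axiLowFreqMultipliers M a ω Λ R P).y x * ⟪H x, u₁ x⟫_ℝ +
        E * (ω * (H x * conj (u x)).im) := by
  have hf : (axiLowFreqMultipliers M a ω Λ R P).f x = 0 := rfl
  have hf' : (axiLowFreqMultipliers M a ω Λ R P).f' x = 0 := rfl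
  have hχ₁ : (axiLowFreqMultipliers M a ω Λ R P).χ₁ x = 0 := rfl
  have hχ₂ : (axiLowFreqMultipliers M a ω Λ R P).χ₂ x = 1 := rfl
  simp only [combinedSource, hf, hf', hχ₁, hχ₂]
  ring

/-- **The source is integrable** when `Re(u'H̄)` and `Im(Hū)` are (and `H` is continuous): `h` is
continuous with compact support, `y` is bounded and continuous. [folklore] -/
theorem integrable_combinedSource_axiLowFreq (hMa : IsSubextremal M a) (hR : IsTortoiseRadius M a R)
    (hP : P.Valid M a ω Λ R) (hσ : 0 ≤ P.σ) (hε : 0 ≤ P.ε) (hε' : 0 ≤ P.ε')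
    (hzone : P.x₁ - (P.T' - 1) ≤ P.x₀ + (P.T - 1))
    (hu : ∀ x, HasDerivAt u (u₁ x) x) (hH : Continuous H)
    (hS₁ : Integrable fun x ↦ ⟪H x, u₁ x⟫_ℝ) (hS₂ : Integrable fun x ↦ (H x * conj (u x)).im) :
    Integrable (combinedSource ω ω E (axiLowFreqMultipliers M a ω Λ R P) u u₁ H) := by
  have hμ := hasDerivs_axiLowFreqMultipliers hMa hR hP
  have huc : Continuous u := continuous_iff_continuousAt.2 fun x ↦ (hu x).continuousAt
  have hhc : Continuous (axiLowFreqMultipliers M a ω Λ R P).h :=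
    continuous_iff_continuousAt.2 fun x ↦ (hμ.dh x).continuousAt
  have hyc : Continuous (axiLowFreqMultipliers M a ω Λ R P).y :=
    continuous_iff_continuousAt.2 fun x ↦ (hμ.dy x).continuousAt
  have hT : 0 < 2 * P.T := by linarith [hP.T_gt]
  have hT' : 0 < 2 * P.T' := by linarith [hP.T'_gt]
  -- `h ⟪H, u⟫` : continuous with compact support
  have hI₁ : Integrable fun x ↦ (axiLowFreqMultipliers M a ω Λ R P).h x * ⟪H x, u x⟫_ℝ := by
    refine Continuous.integrable_of_hasCompactSupport (hhc.mul (hH.inner huc)) ?_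
    refine HasCompactSupport.intro (isCompact_Icc (a := P.x₁ - 2 * P.T' * Real.exp (1 / P.p'))
      (b := P.x₀ + 2 * P.T * Real.exp (1 / P.p))) fun x hx ↦ ?_
    rw [mem_Icc, not_and_or, not_le, not_le] at hx
    have hexp : 1 ≤ Real.exp (1 / P.p) := Real.one_le_exp (one_div_pos.2 hP.p_pos).le
    have hexp' : 1 ≤ Real.exp (1 / P.p') := Real.one_le_exp (one_div_pos.2 hP.p'_pos).le
    rcases hx with hx | hx
    · have h₀ : x - P.x₀ ≤ P.T - 1 := by nlinarith [hP.T'_gt]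
      obtain ⟨e1, -, -, -, -⟩ := axiLowFreq_eq_near hP h₀
      rw [e1, lowFreqCutoff_eq_zero hT' hP.p'_pos (by linarith)]
      simp
    · have h₁ : P.x₁ - x ≤ P.T' - 1 := by nlinarith [hP.T_gt]
      obtain ⟨e1, -, -, -, -⟩ := axiLowFreq_eq_far hP h₁
      rw [e1, lowFreqCutoff_eq_zero hT hP.p_pos (by linarith)]
      simp
  -- `2y ⟪H, u'⟫` : bounded continuous times integrable
  set B := P.σ * max (lowFreqTop P.ε P.u₀ P.U₁) (lowFreqTop P.ε' P.u₀' P.U₁') with hB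
  have hyc2 : Continuous fun x ↦ 2 * (axiLowFreqMultipliers M a ω Λ R P).y x :=
    continuous_const.mul hyc
  have hI₂ : Integrable fun x ↦ 2 * (axiLowFreqMultipliers M a ω Λ R P).y x * ⟪H x, u₁ x⟫_ℝ := by
    refine hS₁.bdd_mul (c := 2 * B) hyc2.aestronglyMeasurable (Eventually.of_forall fun x ↦ ?_)
    have hb := (axiLowFreq_bounds hP hσ hε hε' hzone x).2
    rw [Real.norm_eq_abs, abs_mul, abs_two]
    linarith
  have hI₃ : Integrable fun x ↦ E * (ω * (H x * conj (u x)).im) := (hS₂.const_mul ω).const_mul E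
  have h := (hI₁.neg.sub hI₂).add hI₃
  refine h.congr (Eventually.of_forall fun x ↦ ?_)
  simp only [Pi.add_apply, Pi.sub_apply, Pi.neg_apply]
  rw [combinedSource_axiLowFreq]

end Limits

/-! ### The estimate for given parameters -/

section Estimate

variable {M a ω Λ : ℝ} {R : ℝ → ℝ} {P : LowFreqParams}

/-- **Proposition 8.7.2 for given parameters.** In the situation of `LowFreqParams.Valid` and
`LowFreqParams.Coeff` (validity of the one-sided constructions at both ends, `ω²` below the
potential on the middle and at the ends of the logarithmic zones), with the normalisation
`σY_F(∞) = 1`, `Y_N(∞) ≤ Y_F(∞)`, saturation thresholds `T_s, T_s'`, a middle lower bound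
`V ≥ v ≥ 2ω²` on `[x₁', x₂']`, and `E ≥ 2`: for every solution of `u'' + (ω² − V)u = H` with the
outgoing boundary conditions,
`σ·min(1, v/2) ∫_{x₁'}^{x₂'} (|u'|² + |u|²) ≤ ∫ (−h Re(uH̄) − 2y Re(u'H̄) + Eω Im(Hū))`.
[cite: DafermosRodnianskiShlapentokhrothman2014, Prop. 8.7.2] -/
theorem axiLowFreq_estimate_of_params {D₁ D₂ Ts Ts' v x₁' x₂' E Atop Abot : ℝ}
    {u u₁ u₂ H : ℝ → ℂ} (hMa : IsSubextremal M a) (hR : IsTortoiseRadius M a R)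
    (hadm : IsAdmissibleTriple a ω 0 Λ) (hP : P.Valid M a ω Λ R) (hC : P.Coeff M a ω Λ R D₁ D₂)
    (hD₁ : ∀ s, |sharpBump₁ s| ≤ D₁) (hD₂ : ∀ s, |sharpBump₂ s| ≤ D₂) (hσ : 0 < P.σ)
    (hnorm : P.σ * lowFreqTop P.ε P.u₀ P.U₁ = 1)
    (htop : lowFreqTop P.ε' P.u₀' P.U₁' ≤ lowFreqTop P.ε P.u₀ P.U₁) (hTs : P.T ≤ Ts)
    (hsat : ∀ t, Ts ≤ t → P.U₁ + 1 ≤ lowFreqF (farPotential M a ω Λ R P.x₀) P.T t)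
    (hTs' : P.T' ≤ Ts')
    (hsat' : ∀ t, Ts' ≤ t → P.U₁' + 1 ≤ lowFreqF (nearPotential M a ω Λ R P.x₁) P.T' t)
    (hv : 0 < v) (hωv : 2 * ω ^ 2 ≤ v) (hx : x₁' ≤ x₂') (hx₁' : P.x₁ - (P.T' - 1) ≤ x₁')
    (hx₂' : x₂' ≤ P.x₀ + (P.T - 1)) (hVmid : ∀ x, x₁' ≤ x → x ≤ x₂' → v ≤ sepPotential M a ω 0 Λ (R x))
    (hE : 2 ≤ E) (hu : ∀ x, HasDerivAt u (u₁ x) x) (hu₁ : ∀ x, HasDerivAt u₁ (u₂ x) x)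
    (hode : ∀ x, u₂ x + ((ω ^ 2 - sepPotential M a ω 0 Λ (R x) : ℝ) : ℂ) * u x = H x)
    (hH : Continuous H) (hS₁ : Integrable fun x ↦ ⟪H x, u₁ x⟫_ℝ)
    (hS₂ : Integrable fun x ↦ (H x * conj (u x)).im)
    (hb_top : Tendsto (fun x ↦ u₁ x - Complex.I * ω * u x) atTop (𝓝 0))
    (hb_bot : Tendsto (fun x ↦ u₁ x + Complex.I * ω * u x) atBot (𝓝 0))
    (hA_top : Tendsto (fun x ↦ ‖u x‖ ^ 2) atTop (𝓝 Atop))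
    (hA_bot : Tendsto (fun x ↦ ‖u x‖ ^ 2) atBot (𝓝 Abot)) :
    P.σ * min 1 (v / 2) * ∫ x in x₁'..x₂', (‖u₁ x‖ ^ 2 + ‖u x‖ ^ 2) ≤
      ∫ x, combinedSource ω ω E (axiLowFreqMultipliers M a ω Λ R P) u u₁ H x := by
  have hM := hMa.pos
  set V : ℝ → ℝ := fun x ↦ sepPotential M a ω 0 Λ (R x) with hVdef
  set V₁ : ℝ → ℝ := fun x ↦ deriv (sepPotential M a ω 0 Λ) (R x) *
    (delta M a (R x) / (R x ^ 2 + a ^ 2)) with hV₁def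
  have hV : ∀ x, HasDerivAt V (V₁ x) x := fun x ↦ hasDerivAt_sepPotential_comp hR hMa x
  have hμ := hasDerivs_axiLowFreqMultipliers hMa hR hP
  have hS := integrable_combinedSource_axiLowFreq (E := E) hMa hR hP hσ.le hC.ε_pos.le
    hC.ε'_pos.le hC.zone hu hH hS₁ hS₂
  -- boundary behaviour
  have hV_top : Tendsto V atTop (𝓝 0) := tendsto_sepPotential_comp_atTop hR hMa hadm
  have hV_bot : Tendsto V atBot (𝓝 (ω ^ 2 - ω ^ 2)) := by
    have h := tendsto_sepPotential_comp_atBot (ω := ω) (m := 0) (Λ := Λ) hR hMa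
    push_cast at h
    simpa using h
  have hb : OutgoingBoundary ω ω V u u₁ Atop Abot :=
    ⟨hb_top, hb_bot, hA_top, hA_bot, hV_top, hV_bot⟩
  have htopL := endLimits_axiLowFreq_atTop hP hC.zone hTs hsat
  have hbotL := endLimits_axiLowFreq_atBot hP hC.zone hTs' hsat'
  have hbulk := fun x ↦ combinedBulk_axiLowFreq_nonneg (E := E) (u := u) (u₁ := u₁) hMa hR hP hC
    hσ.le hD₁ hD₂ x
  have hP0 : ∀ x, 0 ≤ combinedBulk ω ω E V V₁ (axiLowFreqMultipliers M a ω Λ R P) u u₁ x :=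
    fun x ↦ (hbulk x).1
  have hmin0 : 0 ≤ min 1 (v / 2) := le_min zero_le_one (by linarith)
  have hcoer : ∀ x ∈ Icc x₁' x₂', P.σ * min 1 (v / 2) * (‖u₁ x‖ ^ 2 + (fun _ ↦ (1 : ℝ)) x * ‖u x‖ ^ 2) ≤
      combinedBulk ω ω E V V₁ (axiLowFreqMultipliers M a ω Λ R P) u u₁ x := by
    intro x hx'
    rw [(hbulk x).2 (by linarith [hx'.1]) (by linarith [hx'.2])]
    have hVx := hVmid x hx'.1 hx'.2
    have h1 : min 1 (v / 2) ≤ 1 := min_le_left _ _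
    have h2 : min 1 (v / 2) ≤ sepPotential M a ω 0 Λ (R x) - ω ^ 2 := by
      have := min_le_right 1 (v / 2); linarith
    have h3 : min 1 (v / 2) * (‖u₁ x‖ ^ 2 + 1 * ‖u x‖ ^ 2) ≤
        ‖u₁ x‖ ^ 2 + (sepPotential M a ω 0 Λ (R x) - ω ^ 2) * ‖u x‖ ^ 2 := by
      nlinarith [mul_le_mul_of_nonneg_right h1 (sq_nonneg ‖u₁ x‖),
        mul_le_mul_of_nonneg_right h2 (sq_nonneg ‖u x‖)]
    calc P.σ * min 1 (v / 2) * (‖u₁ x‖ ^ 2 + (fun _ ↦ (1 : ℝ)) x * ‖u x‖ ^ 2)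
        = P.σ * (min 1 (v / 2) * (‖u₁ x‖ ^ 2 + 1 * ‖u x‖ ^ 2)) := by ring
      _ ≤ P.σ * (‖u₁ x‖ ^ 2 + (sepPotential M a ω 0 Λ (R x) - ω ^ 2) * ‖u x‖ ^ 2) :=
          mul_le_mul_of_nonneg_left h3 hσ.le
  have hsign_top : 2 * (0 + P.σ * lowFreqTop P.ε P.u₀ P.U₁) * ω ^ 2 ≤
      E * (1 * ω ^ 2 + 0 * ω * ω) := by
    rw [hnorm]; nlinarith [sq_nonneg ω]
  have hsign_bot : 0 ≤ 2 * (0 + -(P.σ * lowFreqTop P.ε' P.u₀' P.U₁')) * ω ^ 2 +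
      E * (1 * ω * ω + 0 * ω ^ 2) := by
    have : P.σ * lowFreqTop P.ε' P.u₀' P.U₁' ≤ 1 := by
      rw [← hnorm]; exact mul_le_mul_of_nonneg_left htop hσ.le
    nlinarith [sq_nonneg ω]
  have h := combined_estimate_of_boundary_sign (b := P.σ * min 1 (v / 2)) hV hμ hu hu₁ hode hH hS hb
    htopL hbotL hP0 continuous_const hx hcoer hsign_top hsign_bot
  simpa using h

end Estimate

/-! ### Choice of the parameters: saturation, middle lower bound, and Proposition 8.7.2 -/

section Choice

variable {M a ω Λ Λ₁ : ℝ} {R : ℝ → ℝ}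

/-- `F ≤ 1/(t·w)` whenever `W(t) ≥ w > 0`, `t > 0`, `TW(T) > 0`. [folklore] -/
theorem lowFreqF_le_of_ge {W : ℝ → ℝ} {T t w : ℝ} (ht : 0 < t) (hw : 0 < w) (hWt : w ≤ W t)
    (hWT : 0 < T * W T) : lowFreqF W T t ≤ 1 / (t * w) := by
  unfold lowFreqF
  have h1 : 1 / (t * W t) ≤ 1 / (t * w) :=
    one_div_le_one_div_of_le (by positivity) (by gcongr)
  have h2 : 0 ≤ 1 / (T * W T) := by positivity
  linarith

/-- **Far saturation**: with `T = R_b' + 1` etc. as in `axi_far_data` and `Λ ≤ Λ₁`, for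
`t ≥ max T (12(Λ₁ + 1)(U + 1 + 2T²/M))` one has `F(t) ≥ U + 1` (from `W(t) ≤ 12(Λ₁ + 1)/t²` and
`1/(TW(T)) ≤ 2T²/M`). [folklore] -/
theorem axi_far_saturation (hMa : IsSubextremal M a) (hR : IsTortoiseRadius M a R)
    {Rb' xb x₀ T U t : ℝ} (hRb : 20 * M ≤ Rb') (hxb : R xb = Rb') (hx₀ : x₀ = xb - Rb')
    (hT : T = Rb' + 1) (hadm : IsAdmissibleTriple a ω 0 Λ) (hΛ : Λ ≤ Λ₁)
    (ht : max T (12 * (Λ₁ + 1) * (U + 1 + 2 * T ^ 2 / M)) ≤ t) :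
    U + 1 ≤ lowFreqF (farPotential M a ω Λ R x₀) T t := by
  have hM := hMa.pos
  have hΛ0 := hadm.nonneg
  have hΛ₁ : 0 ≤ Λ₁ := hΛ0.trans hΛ
  have hT1 : T - 1 ≤ t := by have := (le_max_left _ _).trans ht; linarith
  have hT0 : 0 < T := by rw [hT]; linarith
  have ht0 : 0 < t := by linarith
  obtain ⟨-, hWt, -, -⟩ := axi_far_data (ω := ω) hMa hR hRb hxb hx₀ hT hΛ0 hT1
  obtain ⟨-, hWT, -, hWTlo⟩ := axi_far_data (ω := ω) hMa hR hRb hxb hx₀ hT hΛ0 (t := T) (by linarith)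
  have hup : farPotential M a ω Λ R x₀ t ≤ 12 * (Λ₁ + 1) / t ^ 2 :=
    (axi_farPotential_le (ω := ω) hMa hR hRb hxb hx₀ hT hadm hT1).trans (by gcongr)
  unfold lowFreqF
  -- `1/(tW) ≥ t/(12(Λ₁+1))`
  have h1 : t / (12 * (Λ₁ + 1)) ≤ 1 / (t * farPotential M a ω Λ R x₀ t) := by
    rw [div_le_div_iff₀ (by positivity) (by positivity)]
    have := mul_le_mul_of_nonneg_left hup (by positivity : (0 : ℝ) ≤ t ^ 2)
    have e : t ^ 2 * (12 * (Λ₁ + 1) / t ^ 2) = 12 * (Λ₁ + 1) := by field_simp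
    nlinarith
  -- `1/(TW(T)) ≤ 2T²/M`
  have h2 : 1 / (T * farPotential M a ω Λ R x₀ T) ≤ 2 * T ^ 2 / M := by
    rw [div_le_div_iff₀ (by positivity) hM]
    have := mul_le_mul_of_nonneg_left hWTlo (by positivity : (0 : ℝ) ≤ 2 * T ^ 3)
    have e : 2 * T ^ 3 * (M / (2 * T ^ 3)) = M := by field_simp
    nlinarith
  have h3 : 12 * (Λ₁ + 1) * (U + 1 + 2 * T ^ 2 / M) ≤ t := (le_max_right _ _).trans ht
  have h4 : U + 1 + 2 * T ^ 2 / M ≤ t / (12 * (Λ₁ + 1)) := by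
    rw [le_div_iff₀ (by positivity)]; linarith
  linarith

/-- `κ₂ > 0` (`0 < M`, `Λ₁ ≥ 0`). [folklore] -/
theorem horizonDerivBound_pos (hMa : IsSubextremal M a) (hΛ₁ : 0 ≤ Λ₁) :
    0 < horizonDerivBound M a Λ₁ := by
  have hM := hMa.pos
  have hrp0 : 0 < rPlus M a := hM.trans_le (M_le_rPlus M a)
  unfold horizonDerivBound
  positivity

set_option maxHeartbeats 400000 in
/-- **Near saturation**: in the situation of `axi_near_data`, with `c₁ = √(M² − a²)/(4r₊²)`,
`K' = 2e^{1/M}/(T'κ_H s_N)`, for `t ≥ max (2T') (8κ₂ s_N (U + 1 + K')/c₁²)` one has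
`F_N(t) ≥ U + 1` (from `W̃(t) ≤ κ₂ s_N e^{−c₁(t − T' + 1)}`, `e^y ≥ y²/2`). [folklore] -/
theorem axi_near_saturation (hMa : IsSubextremal M a) (hR : IsTortoiseRadius M a R)
    {sN xN x₁ T' U t : ℝ} (hadm : IsAdmissibleTriple a ω 0 Λ) (hΛ : Λ ≤ Λ₁) (hsN : 0 < sN)
    (hsNL : sN * horizonCurv M a Λ₁ ≤ horizonSlope M a / 2) (hsNr : sN ≤ rPlus M a)
    (hxN : R xN = rPlus M a + sN) (hT' : nearThreshold M a Λ₁ + 2 ≤ T')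
    (hx₁ : x₁ = xN + T' - 1)
    (ht : max (2 * T') (8 * horizonDerivBound M a Λ₁ * sN *
      (U + 1 + 2 * Real.exp (1 / M) / (T' * horizonSlope M a * sN)) /
      (√(M ^ 2 - a ^ 2) / (4 * rPlus M a ^ 2)) ^ 2) ≤ t) :
    U + 1 ≤ lowFreqF (nearPotential M a ω Λ R x₁) T' t := by
  have hM := hMa.pos
  have hrp0 : 0 < rPlus M a := hM.trans_le (M_le_rPlus M a)
  have hΛ₁ : 0 ≤ Λ₁ := hadm.nonneg.trans hΛ
  have hκ := horizonSlope_pos hMa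
  have hκ₂ := horizonDerivBound_pos hMa hΛ₁
  have hT₀ := (horizonDerivBound_nonneg hMa hΛ₁).2
  have hsq : 0 < M ^ 2 - a ^ 2 := by
    have := hMa; unfold IsSubextremal at this
    nlinarith [abs_nonneg a, sq_abs a]
  set c₁ := √(M ^ 2 - a ^ 2) / (4 * rPlus M a ^ 2) with hc₁
  have hc₁0 : 0 < c₁ := by rw [hc₁]; exact div_pos (Real.sqrt_pos.2 hsq) (by positivity)
  have hT'1 : 1 < T' := by linarith
  have hT'0 : 0 < T' := by linarith
  have ht2 : 2 * T' ≤ t := (le_max_left _ _).trans ht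
  have htT : T' - 1 ≤ t := by linarith
  have ht0 : 0 < t := by linarith
  -- data at `t` and at `T'`
  obtain ⟨-, hWpos, -, ⟨-, hWup⟩, ⟨-, hRup⟩⟩ :=
    axi_near_data (ω := ω) hMa hR hadm hΛ hsN hsNL hsNr hxN hT' hx₁ htT
  obtain ⟨-, hWTpos, -, ⟨hWTlo, -⟩, ⟨hRTlo, -⟩⟩ :=
    axi_near_data (ω := ω) hMa hR hadm hΛ hsN hsNL hsNr hxN hT' hx₁ (t := T') (by linarith)
  set τ := t - (T' - 1) with hτ
  have hτ0 : 0 ≤ τ := by rw [hτ]; linarith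
  have hτt : t / 2 ≤ τ := by rw [hτ]; linarith
  -- `W̃(t) ≤ κ₂ sN e^{-c₁ τ}`
  have hW : nearPotential M a ω Λ R x₁ t ≤
      horizonDerivBound M a Λ₁ * sN * Real.exp (-c₁ * τ) := by
    refine hWup.trans ?_
    rw [mul_assoc]
    exact mul_le_mul_of_nonneg_left hRup hκ₂.le
  -- `e^{c₁ τ} ≥ (c₁ τ)²/2 ≥ c₁² t²/8`
  have hexp : c₁ ^ 2 * t ^ 2 / 8 ≤ Real.exp (c₁ * τ) := by
    have h := Real.quadratic_le_exp_of_nonneg (mul_nonneg hc₁0.le hτ0)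
    have : c₁ ^ 2 * t ^ 2 / 8 ≤ (c₁ * τ) ^ 2 / 2 := by
      rw [div_le_div_iff₀ (by norm_num) (by norm_num)]
      have := mul_le_mul hτt hτt (by linarith) hτ0
      nlinarith [sq_nonneg c₁]
    nlinarith [mul_nonneg hc₁0.le hτ0]
  -- hence `1/(t W̃) ≥ c₁² t/(8 κ₂ sN)`
  have h1 : c₁ ^ 2 * t / (8 * horizonDerivBound M a Λ₁ * sN) ≤
      1 / (t * nearPotential M a ω Λ R x₁ t) := by
    rw [div_le_div_iff₀ (by positivity) (by positivity)]
    have hE : Real.exp (-c₁ * τ) * Real.exp (c₁ * τ) = 1 := by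
      rw [← Real.exp_add]; simp
    have hpos : 0 < Real.exp (-c₁ * τ) := Real.exp_pos _
    have h2 : c₁ ^ 2 * t ^ 2 / 8 * Real.exp (-c₁ * τ) ≤ 1 := by
      calc c₁ ^ 2 * t ^ 2 / 8 * Real.exp (-c₁ * τ)
          ≤ Real.exp (c₁ * τ) * Real.exp (-c₁ * τ) := mul_le_mul_of_nonneg_right hexp hpos.le
        _ = 1 := by rw [mul_comm, hE]
    have h3 := mul_le_mul_of_nonneg_left hW (by positivity : (0 : ℝ) ≤ c₁ ^ 2 * t ^ 2)
    calc c₁ ^ 2 * t * (t * nearPotential M a ω Λ R x₁ t)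
        = c₁ ^ 2 * t ^ 2 * nearPotential M a ω Λ R x₁ t := by ring
      _ ≤ c₁ ^ 2 * t ^ 2 * (horizonDerivBound M a Λ₁ * sN * Real.exp (-c₁ * τ)) := h3
      _ = (8 * horizonDerivBound M a Λ₁ * sN) * (c₁ ^ 2 * t ^ 2 / 8 * Real.exp (-c₁ * τ)) := by ring
      _ ≤ (8 * horizonDerivBound M a Λ₁ * sN) * 1 := by gcongr
      _ = 1 * (8 * horizonDerivBound M a Λ₁ * sN) := by ring
  -- `K' = 1/(T' W̃(T')) ≤ 2 e^{1/M}/(T' κ_H sN)`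
  have h2 : 1 / (T' * nearPotential M a ω Λ R x₁ T') ≤
      2 * Real.exp (1 / M) / (T' * horizonSlope M a * sN) := by
    have hlo : horizonSlope M a / 2 * (sN * Real.exp (-(T' - (T' - 1)) / M)) ≤
        nearPotential M a ω Λ R x₁ T' :=
      le_trans (mul_le_mul_of_nonneg_left hRTlo (by positivity)) hWTlo
    have e1 : -(T' - (T' - 1)) / M = -(1 / M) := by ring
    rw [e1, Real.exp_neg] at hlo
    rw [div_le_div_iff₀ (by positivity) (by positivity)]
    have hE0 : 0 < Real.exp (1 / M) := Real.exp_pos _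
    have h' := mul_le_mul_of_nonneg_left hlo (by positivity : (0 : ℝ) ≤ 2 * T' * Real.exp (1 / M))
    have e2 : 2 * T' * Real.exp (1 / M) * (horizonSlope M a / 2 * (sN * (Real.exp (1 / M))⁻¹)) =
        T' * horizonSlope M a * sN := by field_simp
    calc 1 * (T' * horizonSlope M a * sN) = T' * horizonSlope M a * sN := one_mul _
      _ = 2 * T' * Real.exp (1 / M) * (horizonSlope M a / 2 * (sN * (Real.exp (1 / M))⁻¹)) := e2.symm
      _ ≤ 2 * T' * Real.exp (1 / M) * nearPotential M a ω Λ R x₁ T' := h'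
      _ = 2 * Real.exp (1 / M) * (T' * nearPotential M a ω Λ R x₁ T') := by ring
  have h3 : 8 * horizonDerivBound M a Λ₁ * sN *
      (U + 1 + 2 * Real.exp (1 / M) / (T' * horizonSlope M a * sN)) / c₁ ^ 2 ≤ t :=
    (le_max_right _ _).trans ht
  have h4 : U + 1 + 2 * Real.exp (1 / M) / (T' * horizonSlope M a * sN) ≤
      c₁ ^ 2 * t / (8 * horizonDerivBound M a Λ₁ * sN) := by
    rw [div_le_iff₀ (by positivity)] at h3
    rw [le_div_iff₀ (by positivity)]
    nlinarith
  unfold lowFreqF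
  linarith

/-- **The middle lower bound**: for `R(x_N) = r₊ + s_N ≤ R(x) ≤ R_b' = R(x_b)` (`R_b' ≥ 20M`),
`V(R(x)) ≥ v := min(s_N(r₊ − r₋)·2Mr₊(r₊² − a²)/(17M²)⁴, M/(2R_b'³))` — the first bullet "`V − ω² > 0`
on compact `r`-intervals for `ω_low` small" of DRSR arXiv:1402.7034, §8.7.2, quantitatively.
[cite: DafermosRodnianskiShlapentokhrothman2014, Prop. 8.7.2 (proof)] -/
theorem axi_mid_lower (hMa : IsSubextremal M a) (hR : IsTortoiseRadius M a R) {sN xN xb Rb' : ℝ}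
    (hsN : 0 < sN) (hxN : R xN = rPlus M a + sN) (hxb : R xb = Rb')
    (hΛ : 0 ≤ Λ) {x : ℝ} (hx₁ : xN ≤ x) (hx₂ : x ≤ xb) :
    min (sN * (rPlus M a - rMinus M a) * (2 * M * rPlus M a * (rPlus M a ^ 2 - a ^ 2)) /
        (17 * M ^ 2) ^ 4) (M / (2 * Rb' ^ 3)) ≤ sepPotential M a ω 0 Λ (R x) := by
  have hM := hMa.pos
  have haM : |a| ≤ M := le_of_lt hMa
  have hmono := (hR.strictMono hMa).monotone
  have h1 : rPlus M a + sN ≤ R x := by rw [← hxN]; exact hmono hx₁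
  have h2 : R x ≤ Rb' := by rw [← hxb]; exact hmono hx₂
  have hrp : rPlus M a ≤ R x := by linarith
  refine le_trans ?_ (sepPotential₁_le_sepPotential_axi haM hrp hΛ ω)
  rcases le_or_gt (R x) (4 * M) with h4 | h4
  · exact (min_le_left _ _).trans (sepPotential₁_ge_near hMa hsN h1 h4)
  · refine (min_le_right _ _).trans (le_trans ?_ (sepPotential₁_ge_of_four_mul_le hM haM h4.le))
    have hR0 : 0 < R x := by linarith
    apply div_le_div_of_nonneg_left hM.le (by positivity)
    gcongr

/-- At the far end: `y = σY_F(∞)` and `h = 0` for `r* ≥ x₀ + max(2Te^{1/p}, T_s)`. [folklore] -/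
theorem axiLowFreq_far_end {P : LowFreqParams} (hP : P.Valid M a ω Λ R)
    (hzone : P.x₁ - (P.T' - 1) ≤ P.x₀ + (P.T - 1)) {Ts : ℝ} (hTs : P.T ≤ Ts)
    (hsat : ∀ t, Ts ≤ t → P.U₁ + 1 ≤ lowFreqF (farPotential M a ω Λ R P.x₀) P.T t) {x : ℝ}
    (hx : P.x₀ + max (2 * P.T * Real.exp (1 / P.p)) Ts ≤ x) :
    (axiLowFreqMultipliers M a ω Λ R P).y x = P.σ * lowFreqTop P.ε P.u₀ P.U₁ ∧
      (axiLowFreqMultipliers M a ω Λ R P).h x = 0 := by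
  have hT : 0 < 2 * P.T := by linarith [hP.T_gt]
  have hexp : 1 ≤ Real.exp (1 / P.p) := Real.one_le_exp (one_div_pos.2 hP.p_pos).le
  have h1 : 2 * P.T * Real.exp (1 / P.p) ≤ x - P.x₀ := by
    have := le_max_left (2 * P.T * Real.exp (1 / P.p)) Ts; linarith
  have h2 : Ts ≤ x - P.x₀ := by have := le_max_right (2 * P.T * Real.exp (1 / P.p)) Ts; linarith
  have hfar : P.x₁ - x ≤ P.T' - 1 := by nlinarith [hP.T_gt]
  obtain ⟨e1, -, -, e4, -⟩ := axiLowFreq_eq_far hP hfar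
  rw [e1, e4, lowFreqCutoff_eq_zero hT hP.p_pos h1,
    lowFreqWeight_eq_top hP.u₀_pos hP.U₁_ge (hTs.trans h2) (hsat _ h2)]
  simp

set_option maxHeartbeats 3000000 in
/-- **Proposition 8.7.2 of DRSR arXiv:1402.7034 (the axisymmetric low-frequency subrange of
`𝓖_♭`), explicit form.** Let `|a| < M`, `R` a tortoise radius function, `Λ₁ ≥ 0` (the bound
`ε_width⁻¹ω_high²` for `Λ` in `𝓖_♭`), `δ₀ > 0`, `R_b` the ends of the region of integration
(`R₋*, R₊*` with `R(R₋*) ≥ r₊ + δ₀`, `R(R₊*) ≤ R_b`). There are `ω₀ > 0` ("`ω_low` sufficiently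
small"), `b > 0` and `X_∞` ("`R*_∞` sufficiently large") such that for every admissible
`(ω, 0, Λ)` with `Λ ≤ Λ₁` and `|ω| ≤ ω₀` there are multipliers `h, y` (the record
`axiLowFreqMultipliers M a ω Λ R P`, `f = χ₁ = 0`, `χ₂ = 1`), differentiable, with the uniform
bounds `0 ≤ h ≤ 2`, `|y| ≤ 1`, with `y = 1` and `h = 0` for `r* ≥ X_∞`, such that for all `E ≥ 2`
and all solutions `u` of `u'' + (ω² − V)u = H` on `ℝ` (`H` continuous, `Re(u'H̄)`, `Im(Hū)`
integrable) with the outgoing boundary conditions `u' − iωu → 0`, `|u|² → A_∞` at `+∞`,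
`u' + iωu → 0`, `|u|² → A_H` at `−∞` ((eq:b±) with `m = 0`):
`b ∫_{x₁}^{x₂} (|u'|² + |u|²) ≤ ∫ (−h Re(uH̄) − 2y Re(u'H̄) + Eω Im(Hū))`
whenever `r₊ + δ₀ ≤ R(x₁)`, `R(x₂) ≤ R_b`. [cite: DafermosRodnianskiShlapentokhrothman2014, Prop. 8.7.2] -/
theorem axiLowFreq_estimate (hMa : IsSubextremal M a) (hR : IsTortoiseRadius M a R) {Λ₁ δ₀ : ℝ}
    (Rb : ℝ) (hΛ₁ : 0 ≤ Λ₁) (hδ₀ : 0 < δ₀) :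
    ∃ ω₀ b X : ℝ, 0 < ω₀ ∧ 0 < b ∧ ∀ (ω Λ : ℝ), IsAdmissibleTriple a ω 0 Λ → Λ ≤ Λ₁ → |ω| ≤ ω₀ →
      ∃ P : LowFreqParams, 0 < P.σ ∧ (axiLowFreqMultipliers M a ω Λ R P).HasDerivs ∧
        (∀ x, (0 ≤ (axiLowFreqMultipliers M a ω Λ R P).h x ∧
          (axiLowFreqMultipliers M a ω Λ R P).h x ≤ 2) ∧
          |(axiLowFreqMultipliers M a ω Λ R P).y x| ≤ 1) ∧
        (∀ x, X ≤ x → (axiLowFreqMultipliers M a ω Λ R P).y x = 1 ∧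
          (axiLowFreqMultipliers M a ω Λ R P).h x = 0) ∧
        ∀ (E : ℝ), 2 ≤ E → ∀ (u u₁ u₂ H : ℝ → ℂ) (Atop Abot x₁ x₂ : ℝ), x₁ ≤ x₂ →
          rPlus M a + δ₀ ≤ R x₁ → R x₂ ≤ Rb →
          (∀ x, HasDerivAt u (u₁ x) x) → (∀ x, HasDerivAt u₁ (u₂ x) x) →
          (∀ x, u₂ x + ((ω ^ 2 - sepPotential M a ω 0 Λ (R x) : ℝ) : ℂ) * u x = H x) →
          Continuous H → Integrable (fun x ↦ ⟪H x, u₁ x⟫_ℝ) →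
          Integrable (fun x ↦ (H x * conj (u x)).im) →
          Tendsto (fun x ↦ u₁ x - Complex.I * ω * u x) atTop (𝓝 0) →
          Tendsto (fun x ↦ u₁ x + Complex.I * ω * u x) atBot (𝓝 0) →
          Tendsto (fun x ↦ ‖u x‖ ^ 2) atTop (𝓝 Atop) →
          Tendsto (fun x ↦ ‖u x‖ ^ 2) atBot (𝓝 Abot) →
          b * ∫ x in x₁..x₂, (‖u₁ x‖ ^ 2 + ‖u x‖ ^ 2) ≤
            ∫ x, combinedSource ω ω E (axiLowFreqMultipliers M a ω Λ R P) u u₁ H x := by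
  have hM := hMa.pos
  have haM : |a| ≤ M := le_of_lt hMa
  have hrpM : M ≤ rPlus M a := M_le_rPlus M a
  have hrp0 : 0 < rPlus M a := hM.trans_le hrpM
  have hsq : 0 < M ^ 2 - a ^ 2 := by
    have := hMa; unfold IsSubextremal at this
    nlinarith [abs_nonneg a, sq_abs a]
  have hroot : 0 < √(M ^ 2 - a ^ 2) := Real.sqrt_pos.2 hsq
  have hrootM : √(M ^ 2 - a ^ 2) ≤ M := by
    rw [Real.sqrt_le_left hM.le]; nlinarith [sq_nonneg a]
  have hrp2 : rPlus M a ≤ 2 * M := by unfold rPlus; linarith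
  have hpm : rPlus M a - rMinus M a = 2 * √(M ^ 2 - a ^ 2) := by unfold rPlus rMinus; ring
  have hpm0 : 0 < rPlus M a - rMinus M a := by rw [hpm]; positivity
  have hra : 0 < rPlus M a ^ 2 - a ^ 2 := by
    have h1 : |a| < rPlus M a := lt_of_le_of_lt haM (by unfold rPlus; linarith)
    have h2 : 0 ≤ rPlus M a - |a| := by linarith
    have h3 : rPlus M a ^ 2 - a ^ 2 = (rPlus M a - |a|) * (rPlus M a + |a|) := by
      rw [← sq_abs a]; ring
    rw [h3]
    exact mul_pos (by linarith) (by linarith [abs_nonneg a])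
  obtain ⟨D₁, hD₁0, hD₁⟩ := exists_bound_sharpBump₁
  obtain ⟨D₂, hD₂0, hD₂⟩ := exists_bound_sharpBump₂
  have hκ := horizonSlope_pos hMa
  obtain ⟨κH, hκH⟩ : ∃ κH, κH = horizonSlope M a := ⟨_, rfl⟩
  have hκH0 : 0 < κH := by rw [hκH]; exact hκ
  obtain ⟨L, hL⟩ : ∃ L, L = horizonCurv M a Λ₁ := ⟨_, rfl⟩
  have hL0 : 0 ≤ L := by rw [hL]; unfold horizonCurv; positivity
  -- the near margin `sN`
  obtain ⟨sN, hsN⟩ : ∃ sN, sN = min δ₀ (min (κH / (2 * (L + 1))) (rPlus M a)) := ⟨_, rfl⟩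
  have hsN0 : 0 < sN := by rw [hsN]; exact lt_min hδ₀ (lt_min (by positivity) hrp0)
  have hsNδ : sN ≤ δ₀ := by rw [hsN]; exact min_le_left _ _
  have hsNr : sN ≤ rPlus M a := by rw [hsN]; exact (min_le_right _ _).trans (min_le_right _ _)
  have hsNL : sN * horizonCurv M a Λ₁ ≤ horizonSlope M a / 2 := by
    rw [← hL, ← hκH]
    have h1 : sN ≤ κH / (2 * (L + 1)) := by rw [hsN]; exact (min_le_right _ _).trans (min_le_left _ _)
    rw [le_div_iff₀ (by positivity)] at h1
    have h2 : sN * L ≤ sN * (L + 1) := mul_le_mul_of_nonneg_left (by linarith) hsN0.le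
    linarith only [h1, h2]
  obtain ⟨xN, hxN⟩ := hR.exists_eq hMa (show rPlus M a < rPlus M a + sN by linarith)
  -- the far radius `Rb'`
  obtain ⟨Rb', hRb'⟩ : ∃ Rb', Rb' = max Rb (20 * M) := ⟨_, rfl⟩
  have hRb20 : 20 * M ≤ Rb' := by rw [hRb']; exact le_max_right _ _
  have hRbRb : Rb ≤ Rb' := by rw [hRb']; exact le_max_left _ _
  have hRb0 : 0 < Rb' := by linarith
  obtain ⟨xb, hxb⟩ := hR.exists_eq hMa (show rPlus M a < Rb' by linarith)
  have hxNb : xN < xb := by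
    rw [← (hR.strictMono hMa).lt_iff_lt, hxN, hxb]; linarith
  obtain ⟨x₀, hx₀⟩ : ∃ x₀, x₀ = xb - Rb' := ⟨_, rfl⟩
  obtain ⟨T, hT⟩ : ∃ T, T = Rb' + 1 := ⟨_, rfl⟩
  have hT1 : 1 < T := by rw [hT]; linarith
  have hT0 : 0 < T := by linarith
  -- the near origin
  obtain ⟨T', hT'⟩ : ∃ T', T' = nearThreshold M a Λ₁ + 2 := ⟨_, rfl⟩
  have hT'ge : nearThreshold M a Λ₁ + 2 ≤ T' := hT'.ge
  have hT'1 : 1 < T' := by rw [hT']; linarith [(horizonDerivBound_nonneg hMa hΛ₁).2]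
  have hT'0 : 0 < T' := by linarith
  obtain ⟨x₁, hx₁⟩ : ∃ x₁, x₁ = xN + T' - 1 := ⟨_, rfl⟩
  -- far gain and rate
  obtain ⟨ε, hε⟩ : ∃ ε, ε = M / (10 * T ^ 2) := ⟨_, rfl⟩
  have hε0 : 0 < ε := by rw [hε]; positivity
  obtain ⟨p, hp⟩ : ∃ p, p = min 1 (2 * ε / (D₁ + D₂ + 1)) := ⟨_, rfl⟩
  have hp0 : 0 < p := by rw [hp]; exact lt_min one_pos (by positivity)
  have hp1 : p ≤ 1 := by rw [hp]; exact min_le_left _ _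
  have hpε : p * (D₁ + D₂) ≤ 2 * ε := by
    have h1 : p ≤ 2 * ε / (D₁ + D₂ + 1) := by rw [hp]; exact min_le_right _ _
    rw [le_div_iff₀ (by positivity)] at h1
    have h2 : p * (D₁ + D₂) ≤ p * (D₁ + D₂ + 1) := mul_le_mul_of_nonneg_left (by linarith) hp0.le
    linarith only [h1, h2]
  obtain ⟨Te, hTe⟩ : ∃ Te, Te = 2 * T * Real.exp (1 / p) := ⟨_, rfl⟩
  have hexp1 : 1 ≤ Real.exp (1 / p) := Real.one_le_exp (one_div_pos.2 hp0).le
  have hTe2 : 2 * T ≤ Te := by rw [hTe]; exact le_mul_of_one_le_right (by linarith) hexp1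
  have hTeT : T - 1 ≤ Te := by linarith only [hTe2, hT0]
  have hTe0 : 0 < Te := by linarith
  -- near gain and rate
  obtain ⟨ε', hε'⟩ : ∃ ε', ε' = T' * κH * sN * Real.exp (-(1 / M)) / 10 := ⟨_, rfl⟩
  have hε'0 : 0 < ε' := by rw [hε']; positivity
  obtain ⟨p', hp'⟩ : ∃ p', p' = min 1 (2 * ε' / (D₁ + D₂ + 1)) := ⟨_, rfl⟩
  have hp'0 : 0 < p' := by rw [hp']; exact lt_min one_pos (by positivity)
  have hp'1 : p' ≤ 1 := by rw [hp']; exact min_le_left _ _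
  have hpε' : p' * (D₁ + D₂) ≤ 2 * ε' := by
    have h1 : p' ≤ 2 * ε' / (D₁ + D₂ + 1) := by rw [hp']; exact min_le_right _ _
    rw [le_div_iff₀ (by positivity)] at h1
    have h2 : p' * (D₁ + D₂) ≤ p' * (D₁ + D₂ + 1) := mul_le_mul_of_nonneg_left (by linarith) hp'0.le
    linarith only [h1, h2]
  obtain ⟨Te', hTe'⟩ : ∃ Te', Te' = 2 * T' * Real.exp (1 / p') := ⟨_, rfl⟩
  have hexp1' : 1 ≤ Real.exp (1 / p') := Real.one_le_exp (one_div_pos.2 hp'0).le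
  have hTe'2 : 2 * T' ≤ Te' := by rw [hTe']; exact le_mul_of_one_le_right (by linarith) hexp1'
  have hTe'T : T' - 1 ≤ Te' := by linarith only [hTe'2, hT'0]
  have hTe'0 : 0 < Te' := by linarith
  -- frequency thresholds
  obtain ⟨ω₁, hω₁⟩ : ∃ ω₁, ω₁ = M / (2 * Te ^ 3) := ⟨_, rfl⟩
  have hω₁0 : 0 < ω₁ := by rw [hω₁]; positivity
  obtain ⟨ω₂, hω₂⟩ : ∃ ω₂, ω₂ = κH / 2 * (sN * Real.exp (-(Te' - (T' - 1)) / M)) := ⟨_, rfl⟩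
  have hω₂0 : 0 < ω₂ := by rw [hω₂]; positivity
  obtain ⟨v, hv⟩ : ∃ v, v = min (sN * (rPlus M a - rMinus M a) *
    (2 * M * rPlus M a * (rPlus M a ^ 2 - a ^ 2)) / (17 * M ^ 2) ^ 4) (M / (2 * Rb' ^ 3)) := ⟨_, rfl⟩
  have hv0 : 0 < v := by
    rw [hv]
    exact lt_min (by positivity) (by positivity)
  obtain ⟨ω₀, hω₀⟩ : ∃ ω₀, ω₀ = √(min (v / 2) (min ω₁ ω₂)) := ⟨_, rfl⟩
  have hmin0 : 0 < min (v / 2) (min ω₁ ω₂) := lt_min (by linarith) (lt_min hω₁0 hω₂0)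
  have hω₀0 : 0 < ω₀ := by rw [hω₀]; exact Real.sqrt_pos.2 hmin0
  -- uniform bounds for the saturation levels
  obtain ⟨BN, hBN⟩ : ∃ BN, BN = 1 / 2 + ε' * (1 / (Te' * ω₂) + 1 / 2) := ⟨_, rfl⟩
  have hBN0 : 0 < BN := by rw [hBN]; positivity
  obtain ⟨U₁max, hU₁max⟩ : ∃ U₁max, U₁max = max (1 / (Te * ω₁)) (BN / ε) := ⟨_, rfl⟩
  have hU₁max0 : 0 ≤ U₁max := by rw [hU₁max]; exact le_max_of_le_left (by positivity)
  obtain ⟨BF, hBF⟩ : ∃ BF, BF = 1 / 2 + ε * (U₁max + 1 / 2) := ⟨_, rfl⟩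
  have hBF0 : 0 < BF := by rw [hBF]; positivity
  obtain ⟨b, hb⟩ : ∃ b, b = min 1 (v / 2) / BF := ⟨_, rfl⟩
  have hb0 : 0 < b := by rw [hb]; exact div_pos (lt_min one_pos (by linarith)) hBF0
  obtain ⟨Ts, hTs⟩ : ∃ Ts, Ts = max T (12 * (Λ₁ + 1) * (U₁max + 1 + 2 * T ^ 2 / M)) := ⟨_, rfl⟩
  have hTsT : T ≤ Ts := by rw [hTs]; exact le_max_left _ _
  obtain ⟨X, hX⟩ : ∃ X, X = x₀ + max Te Ts := ⟨_, rfl⟩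
  refine ⟨ω₀, b, X, hω₀0, hb0, fun ω Λ hadm hΛ hω ↦ ?_⟩
  -- now fix the triple
  have hΛ0 := hadm.nonneg
  have hω2 : ω ^ 2 ≤ min (v / 2) (min ω₁ ω₂) := by
    have h1 : ω ^ 2 ≤ ω₀ ^ 2 := by
      rw [← sq_abs ω]; exact pow_le_pow_left₀ (abs_nonneg ω) hω 2
    rwa [hω₀, Real.sq_sqrt hmin0.le] at h1
  have hωv : ω ^ 2 ≤ v / 2 := hω2.trans (min_le_left _ _)
  have hωω₁ : ω ^ 2 ≤ ω₁ := hω2.trans ((min_le_right _ _).trans (min_le_left _ _))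
  have hωω₂ : ω ^ 2 ≤ ω₂ := hω2.trans ((min_le_right _ _).trans (min_le_right _ _))
  -- far data
  have hfar := fun t (ht : T - 1 ≤ t) ↦ axi_far_data (ω := ω) (Λ := Λ) hMa hR hRb20 hxb hx₀ hT hΛ0 ht
  have hnear := fun t (ht : T' - 1 ≤ t) ↦
    axi_near_data (ω := ω) hMa hR hadm hΛ hsN0 hsNL hsNr hxN hT'ge hx₁ ht
  set WF := farPotential M a ω Λ R x₀ with hWF
  set WN := nearPotential M a ω Λ R x₁ with hWN
  have hWFT : M / (2 * T ^ 3) ≤ WF T := (hfar T (by linarith)).2.2.2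
  have hWFT0 : 0 < WF T := (hfar T (by linarith)).2.1
  have hWNT0 : 0 < WN T' := (hnear T' (by linarith)).2.1
  have hWNTlo : κH / 2 * (sN * Real.exp (-(1 / M))) ≤ WN T' := by
    obtain ⟨-, -, -, ⟨hlo, -⟩, ⟨hRlo, -⟩⟩ := hnear T' (by linarith)
    have e1 : -(T' - (T' - 1)) / M = -(1 / M) := by ring
    rw [e1] at hRlo
    rw [hκH]
    exact le_trans (mul_le_mul_of_nonneg_left hRlo (by positivity)) hlo
  -- per-triple levels
  obtain ⟨u₀, hu₀⟩ : ∃ u₀, u₀ = 1 / 2 / (4 * T * WF T) := ⟨_, rfl⟩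
  have hu₀0 : 0 < u₀ := by rw [hu₀]; positivity
  obtain ⟨u₀', hu₀'⟩ : ∃ u₀', u₀' = 1 / 2 / (4 * T' * WN T') := ⟨_, rfl⟩
  have hu₀'0 : 0 < u₀' := by rw [hu₀']; positivity
  obtain ⟨U₁', hU₁'⟩ : ∃ U₁', U₁' = lowFreqF WN T' Te' := ⟨_, rfl⟩
  obtain ⟨U₁, hU₁⟩ : ∃ U₁, U₁ = max (lowFreqF WF T Te) (BN / ε) := ⟨_, rfl⟩
  -- the hypotheses of the one-sided lemmas
  have hWFd : ∀ t, T - 1 ≤ t → HasDerivAt WF (farPotentialDeriv M a ω Λ R x₀ t) t :=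
    fun t _ ↦ hasDerivAt_farPotential hR hMa x₀ t
  have hWFpos : ∀ t, T - 1 ≤ t → 0 < WF t := fun t ht ↦ (hfar t ht).2.1
  have hWFdec : ∀ t, T - 1 ≤ t → (1 + 1 / 2) * WF t ≤ -(t * farPotentialDeriv M a ω Λ R x₀ t) :=
    fun t ht ↦ (hfar t ht).2.2.1
  have hWNd : ∀ t, T' - 1 ≤ t → HasDerivAt WN (nearPotentialDeriv M a ω Λ R x₁ t) t :=
    fun t _ ↦ hasDerivAt_nearPotential hR hMa x₁ t
  have hWNpos : ∀ t, T' - 1 ≤ t → 0 < WN t := fun t ht ↦ (hnear t ht).2.1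
  have hWNdec : ∀ t, T' - 1 ≤ t → (1 + 1 / 2) * WN t ≤ -(t * nearPotentialDeriv M a ω Λ R x₁ t) :=
    fun t ht ↦ (hnear t ht).2.2.1
  have hc : (0 : ℝ) ≤ 1 / 2 := by norm_num
  have hmonoF := lowFreqF_monotoneOn hT1 hc hWFd hWFpos hWFdec
  have hmonoN := lowFreqF_monotoneOn hT'1 hc hWNd hWNpos hWNdec
  have hu₀F : u₀ ≤ lowFreqF WF T (2 * T) := lowFreq_u₀_le hT1 hc hWFd hWFpos hWFdec hu₀
  have hu₀N : u₀' ≤ lowFreqF WN T' (2 * T') := lowFreq_u₀_le hT'1 hc hWNd hWNpos hWNdec hu₀'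
  have hU₁ge : lowFreqF WF T Te ≤ U₁ := by rw [hU₁]; exact le_max_left _ _
  have hu₀U₁ : u₀ ≤ U₁ := hu₀F.trans ((hmonoF (by simp only [mem_Ici]; linarith)
    (by simp only [mem_Ici]; linarith) hTe2).trans hU₁ge)
  have hu₀U₁' : u₀' ≤ U₁' := hu₀N.trans (le_of_le_of_eq (hmonoN (by simp only [mem_Ici]; linarith)
    (by simp only [mem_Ici]; linarith) hTe'2) hU₁'.symm)
  -- ω below the potential at the ends of the log zones and in the middle
  have hωF : ω ^ 2 ≤ WF Te := by
    refine hωω₁.trans (le_trans ?_ (hfar Te hTeT).2.2.2)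
    rw [hω₁]
  have hWNTe : ω₂ ≤ WN Te' := by
    obtain ⟨-, -, -, ⟨hlo, -⟩, ⟨hRlo, -⟩⟩ := hnear Te' hTe'T
    rw [hω₂, hκH]
    exact le_trans (mul_le_mul_of_nonneg_left hRlo (by positivity)) hlo
  have hωN : ω ^ 2 ≤ WN Te' := hωω₂.trans hWNTe
  -- gains
  have hεK : 5 * ε ≤ T * WF T := by
    rw [hε]
    have := mul_le_mul_of_nonneg_left hWFT hT0.le
    have e : T * (M / (2 * T ^ 3)) = 5 * (M / (10 * T ^ 2)) := by field_simp; ring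
    linarith
  have hεK' : 5 * ε' ≤ T' * WN T' := by
    rw [hε']
    have e : 5 * (T' * κH * sN * Real.exp (-(1 / M)) / 10) =
        T' * (κH / 2 * (sN * Real.exp (-(1 / M)))) := by ring
    rw [e]
    exact mul_le_mul_of_nonneg_left hWNTlo hT'0.le
  -- tops
  have htopN : lowFreqTop ε' u₀' U₁' ≤ BN := by
    rw [hBN]
    unfold lowFreqTop
    have h1 : U₁' ≤ 1 / (Te' * ω₂) := by
      rw [hU₁']
      exact lowFreqF_le_of_ge (by linarith) hω₂0 hWNTe (mul_pos hT'0 hWNT0)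
    have h2 : U₁' - u₀' / 2 + 1 / 2 ≤ 1 / (Te' * ω₂) + 1 / 2 := by linarith only [h1, hu₀'0]
    have h3 := mul_le_mul_of_nonneg_left h2 hε'0.le
    linarith only [h3]
  have htopF : BN ≤ lowFreqTop ε u₀ U₁ := by
    unfold lowFreqTop
    have h1 : BN / ε ≤ U₁ := by rw [hU₁]; exact le_max_right _ _
    rw [div_le_iff₀ hε0] at h1
    have h2 : ε * u₀ ≤ 1 / 40 := by
      rw [hu₀]
      have e : ε * (1 / 2 / (4 * T * WF T)) = ε / (8 * (T * WF T)) := by field_simp; ring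
      rw [e, div_le_div_iff₀ (by positivity) (by norm_num)]
      linarith only [hεK]
    have e : 1 / 2 + ε * (U₁ - u₀ / 2 + 1 / 2) = (1 / 2 - ε * u₀ / 2 + ε / 2) + ε * U₁ := by ring
    rw [e]
    linarith only [h1, h2, hε0]
  have htop : lowFreqTop ε' u₀' U₁' ≤ lowFreqTop ε u₀ U₁ := htopN.trans htopF
  have htopF0 : 0 < lowFreqTop ε u₀ U₁ := hBN0.trans_le htopF
  have htopFle : lowFreqTop ε u₀ U₁ ≤ BF := by
    rw [hBF]
    unfold lowFreqTop
    have h1 : U₁ ≤ U₁max := by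
      rw [hU₁, hU₁max]
      refine max_le_max ?_ le_rfl
      exact lowFreqF_le_of_ge hTe0 hω₁0 (by rw [hω₁]; exact (hfar Te hTeT).2.2.2) (mul_pos hT0 hWFT0)
    have h2 : U₁ - u₀ / 2 + 1 / 2 ≤ U₁max + 1 / 2 := by linarith only [h1, hu₀0]
    have h3 := mul_le_mul_of_nonneg_left h2 hε0.le
    linarith only [h3]
  have htopFge : 1 / 2 ≤ lowFreqTop ε u₀ U₁ := by
    unfold lowFreqTop
    have h1 : 0 ≤ U₁ - u₀ / 2 + 1 / 2 := by linarith only [hu₀U₁, hu₀0]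
    have h2 := mul_nonneg hε0.le h1
    linarith only [h2]
  obtain ⟨σ, hσ⟩ : ∃ σ, σ = 1 / lowFreqTop ε u₀ U₁ := ⟨_, rfl⟩
  have hσ0 : 0 < σ := by rw [hσ]; positivity
  have hσ2 : σ ≤ 2 := by
    rw [hσ, div_le_iff₀ htopF0]; linarith only [htopFge]
  have hnorm : σ * lowFreqTop ε u₀ U₁ = 1 := by rw [hσ]; field_simp
  -- the parameter record
  set P : LowFreqParams := ⟨σ, x₀, T, ε, p, u₀, U₁, x₁, T', ε', p', u₀', U₁'⟩ with hPdef
  have hPV : P.Valid M a ω Λ R :=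
    ⟨hT1, hT'1, hp0, hp'0, hu₀0, hu₀'0, hu₀U₁, hu₀U₁', hWFpos, hWFdec, hWNpos, hWNdec⟩
  have hzone : P.x₁ - (P.T' - 1) ≤ P.x₀ + (P.T - 1) := by
    show x₁ - (T' - 1) ≤ x₀ + (T - 1)
    rw [hx₁, hx₀, hT]; linarith
  have hPC : P.Coeff M a ω Λ R D₁ D₂ := by
    refine ⟨hε0, hε'0, hp1, hp'1, hpε, hpε', hεK, hεK', hu₀, hu₀', ?_, ?_, ?_, ?_, hzone, ?_⟩
    · show lowFreqF WF T (2 * T * Real.exp (1 / p)) ≤ U₁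
      rw [← hTe]; exact hU₁ge
    · show lowFreqF WN T' (2 * T' * Real.exp (1 / p')) ≤ U₁'
      rw [← hTe', hU₁']
    · show ω ^ 2 ≤ WF (2 * T * Real.exp (1 / p))
      rw [← hTe]; exact hωF
    · show ω ^ 2 ≤ WN (2 * T' * Real.exp (1 / p'))
      rw [← hTe']; exact hωN
    · intro x hx1 hx2
      have hx1' : xN ≤ x := by
        have e : P.x₁ - (P.T' - 1) = xN := by show x₁ - (T' - 1) = xN; rw [hx₁]; ring
        linarith
      have hx2' : x ≤ xb := by
        have e : P.x₀ + (P.T - 1) = xb := by show x₀ + (T - 1) = xb; rw [hx₀, hT]; ring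
        linarith
      have h := axi_mid_lower (ω := ω) hMa hR hsN0 hxN hxb hΛ0 hx1' hx2'
      rw [← hv] at h
      linarith
  -- saturation
  have hsat : ∀ t, Ts ≤ t → P.U₁ + 1 ≤ lowFreqF (farPotential M a ω Λ R P.x₀) P.T t := by
    intro t ht
    show U₁ + 1 ≤ lowFreqF WF T t
    have h1 : U₁ ≤ U₁max := by
      rw [hU₁, hU₁max]
      refine max_le_max ?_ le_rfl
      exact lowFreqF_le_of_ge hTe0 hω₁0 (by rw [hω₁]; exact (hfar Te hTeT).2.2.2) (mul_pos hT0 hWFT0)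
    have h2 := axi_far_saturation (ω := ω) (U := U₁max) hMa hR hRb20 hxb hx₀ hT hadm hΛ
      (t := t) (by rw [← hTs]; exact ht)
    linarith
  obtain ⟨Ts', hTs'⟩ : ∃ Ts', Ts' = max (2 * T') (8 * horizonDerivBound M a Λ₁ * sN *
      (U₁' + 1 + 2 * Real.exp (1 / M) / (T' * horizonSlope M a * sN)) /
      (√(M ^ 2 - a ^ 2) / (4 * rPlus M a ^ 2)) ^ 2) := ⟨_, rfl⟩
  have hTs'T : P.T' ≤ Ts' := by show T' ≤ Ts'; rw [hTs']; exact le_max_of_le_left (by linarith)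
  have hsat' : ∀ t, Ts' ≤ t → P.U₁' + 1 ≤ lowFreqF (nearPotential M a ω Λ R P.x₁) P.T' t := by
    intro t ht
    show U₁' + 1 ≤ lowFreqF WN T' t
    exact axi_near_saturation (ω := ω) (U := U₁') hMa hR hadm hΛ hsN0 hsNL hsNr hxN hT'ge hx₁
      (t := t) (by rw [← hTs']; exact ht)
  have hμ := hasDerivs_axiLowFreqMultipliers hMa hR hPV
  refine ⟨P, hσ0, hμ, fun x ↦ ?_, fun x hx ↦ ?_, ?_⟩
  · -- uniform bounds
    obtain ⟨⟨h1, h2⟩, h3⟩ := axiLowFreq_bounds (M := M) (a := a) (ω := ω) (Λ := Λ) (R := R)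
      hPV hσ0.le hε0.le hε'0.le hzone x
    refine ⟨⟨h1, h2.trans hσ2⟩, h3.trans ?_⟩
    show σ * max (lowFreqTop ε u₀ U₁) (lowFreqTop ε' u₀' U₁') ≤ 1
    rw [max_eq_left htop, hnorm]
  · -- far end: `y = 1`, `h = 0`
    have hx' : P.x₀ + max (2 * P.T * Real.exp (1 / P.p)) Ts ≤ x := by
      show x₀ + max (2 * T * Real.exp (1 / p)) Ts ≤ x
      rw [← hTe]; rw [hX] at hx; exact hx
    obtain ⟨e1, e2⟩ := axiLowFreq_far_end hPV hzone hTsT hsat hx'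
    refine ⟨?_, e2⟩
    rw [e1]
    exact hnorm
  · intro E hE u u₁ u₂ H Atop Abot x₁' x₂' hx hRx₁ hRx₂ hu hu₁ hode hH hS₁ hS₂ hbt hbb hAt hAb
    have hx₁' : P.x₁ - (P.T' - 1) ≤ x₁' := by
      have e : P.x₁ - (P.T' - 1) = xN := by show x₁ - (T' - 1) = xN; rw [hx₁]; ring
      rw [e, ← (hR.strictMono hMa).le_iff_le, hxN]
      linarith
    have hx₂' : x₂' ≤ P.x₀ + (P.T - 1) := by
      have e : P.x₀ + (P.T - 1) = xb := by show x₀ + (T - 1) = xb; rw [hx₀, hT]; ring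
      rw [e, ← (hR.strictMono hMa).le_iff_le, hxb]
      linarith
    have hVmid : ∀ x, x₁' ≤ x → x ≤ x₂' → v ≤ sepPotential M a ω 0 Λ (R x) := by
      intro x h1 h2
      have hx1' : xN ≤ x := by
        have e : P.x₁ - (P.T' - 1) = xN := by show x₁ - (T' - 1) = xN; rw [hx₁]; ring
        linarith
      have hx2'' : x ≤ xb := by
        have e : P.x₀ + (P.T - 1) = xb := by show x₀ + (T - 1) = xb; rw [hx₀, hT]; ring
        linarith
      have h := axi_mid_lower (ω := ω) hMa hR hsN0 hxN hxb hΛ0 hx1' hx2''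
      rwa [← hv] at h
    have hest := axiLowFreq_estimate_of_params (P := P) hMa hR hadm hPV hPC hD₁ hD₂ hσ0 hnorm htop
      hTsT hsat hTs'T hsat' hv0 (by linarith) hx hx₁' hx₂' hVmid hE hu hu₁ hode hH hS₁ hS₂ hbt hbb
      hAt hAb
    -- `b ≤ σ min(1, v/2)`
    have hbσ : b ≤ P.σ * min 1 (v / 2) := by
      show b ≤ σ * min 1 (v / 2)
      rw [hb, hσ, div_eq_mul_one_div, mul_comm]
      refine mul_le_mul_of_nonneg_right ?_ (le_min zero_le_one (by linarith))
      exact one_div_le_one_div_of_le htopF0 htopFle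
    have hI0 : 0 ≤ ∫ x in x₁'..x₂', (‖u₁ x‖ ^ 2 + ‖u x‖ ^ 2) :=
      intervalIntegral.integral_nonneg hx fun x _ ↦ by positivity
    exact le_trans (mul_le_mul_of_nonneg_right hbσ hI0) hest


/-- **Proposition 8.7.2 in the `𝓖_♭` form**: the same statement for the triples
`(ω, 0, Λ) ∈ 𝓖_♭(ω_high, ε_width)` (`KerrFrequencyRanges.IsFreqFlat`: admissible, `|ω| < ω_high`,
`Λ < ε_width⁻¹ω_high²`) with `|ω| ≤ ω₀` ("for all `ω_low > 0` sufficiently small depending on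
`ω_high` and `ε_width`"). [cite: DafermosRodnianskiShlapentokhrothman2014, Prop. 8.7.2] -/
theorem axiLowFreq_estimate_of_isFreqFlat (hMa : IsSubextremal M a) (hR : IsTortoiseRadius M a R)
    {ωh ε δ₀ : ℝ} (Rb : ℝ) (hε : 0 < ε) (hδ₀ : 0 < δ₀) :
    ∃ ω₀ b X : ℝ, 0 < ω₀ ∧ 0 < b ∧ ∀ (ω Λ : ℝ), IsFreqFlat a ωh ε ω 0 Λ → |ω| ≤ ω₀ →
      ∃ P : LowFreqParams, 0 < P.σ ∧ (axiLowFreqMultipliers M a ω Λ R P).HasDerivs ∧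
        (∀ x, (0 ≤ (axiLowFreqMultipliers M a ω Λ R P).h x ∧
          (axiLowFreqMultipliers M a ω Λ R P).h x ≤ 2) ∧
          |(axiLowFreqMultipliers M a ω Λ R P).y x| ≤ 1) ∧
        (∀ x, X ≤ x → (axiLowFreqMultipliers M a ω Λ R P).y x = 1 ∧
          (axiLowFreqMultipliers M a ω Λ R P).h x = 0) ∧
        ∀ (E : ℝ), 2 ≤ E → ∀ (u u₁ u₂ H : ℝ → ℂ) (Atop Abot x₁ x₂ : ℝ), x₁ ≤ x₂ →
          rPlus M a + δ₀ ≤ R x₁ → R x₂ ≤ Rb →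
          (∀ x, HasDerivAt u (u₁ x) x) → (∀ x, HasDerivAt u₁ (u₂ x) x) →
          (∀ x, u₂ x + ((ω ^ 2 - sepPotential M a ω 0 Λ (R x) : ℝ) : ℂ) * u x = H x) →
          Continuous H → Integrable (fun x ↦ ⟪H x, u₁ x⟫_ℝ) →
          Integrable (fun x ↦ (H x * conj (u x)).im) →
          Tendsto (fun x ↦ u₁ x - Complex.I * ω * u x) atTop (𝓝 0) →
          Tendsto (fun x ↦ u₁ x + Complex.I * ω * u x) atBot (𝓝 0) →
          Tendsto (fun x ↦ ‖u x‖ ^ 2) atTop (𝓝 Atop) →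
          Tendsto (fun x ↦ ‖u x‖ ^ 2) atBot (𝓝 Abot) →
          b * ∫ x in x₁..x₂, (‖u₁ x‖ ^ 2 + ‖u x‖ ^ 2) ≤
            ∫ x, combinedSource ω ω E (axiLowFreqMultipliers M a ω Λ R P) u u₁ H x := by
  have hΛ₁ : 0 ≤ ε⁻¹ * ωh ^ 2 := by positivity
  obtain ⟨ω₀, b, X, hω₀, hb, H⟩ := axiLowFreq_estimate hMa hR Rb hΛ₁ hδ₀
  exact ⟨ω₀, b, X, hω₀, hb, fun ω Λ hF hω ↦ H ω Λ hF.1 hF.2.2.le hω⟩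

end Choice

end Kerr

end Literature.Geometry.Lorentzian
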